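import Literature.Geometry.Riemannian.ChernTransgressionFock
import Literature.Geometry.Riemannian.ChernTransgression
import Mathlib.Algebra.Polynomial.Derivative
import Mathlib.Algebra.Polynomial.Degree.Support
import Mathlib.Algebra.Polynomial.Eval.Coeff

/-!
# Chern's transgression: the algebraic core in the Fock model

Support file for `Literature.Geometry.Riemannian.div_chernTransgression_eq_eulerDensity`.
At a fixed point we are given real arrays: the lowered unit field `u_a`, its raised version `vᵃ`,
the covariant derivative `N_{ak} = (∇ₖu)_a`, the covariant Riemann tensor `R_{abkl}`, the
Christoffel symbols `Γᵃᵢ_b`, and "derivative arrays" `δu, δN, δR` standing for the coordinate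
partial derivatives of `u, N, R` at the point. Assuming only the pointwise algebraic identities that
the calculus supplies (unit length, `v·N = 0`, skewness of `R`, metric compatibility (S1), the
structure equation (S2) and the second Bianchi identity (S3)), we prove Chern's recursion and the
telescoped identity relating the formal divergence of the transgression element to the Berezin
integral of `Ω̂ᵖ` (Mathai–Quillen form of Chern's argument, [cite: Chern1945, (9)–(11)]).

Elements of the operator algebra: `S = uₐχᵃ`, `H = N_{ak}θᵏχᵃ`, `Ω̂ = ¼R_{abkl}θᵏθˡχᵃχᵇ`,
`K = -½R_{abkl}vᵇθᵏθˡχᵃ = [a_v, Ω̂]`, `a_v = vᵃ∂/∂χᵃ`, `Gᵢ = -Γᵃᵢ_b χᵇ∂/∂χᵃ` (so that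
`[Gᵢ, ·]` is the covariant correction on lower fibre indices).
-/

noncomputable section

open Finset Matrix
open scoped Nat

namespace Literature.Geometry.Riemannian.Fock

open scoped IsMulCommutative

variable {d : ℕ}

/-! ### The structure elements -/

/-- `S(u) = ∑ₐ uₐ χᵃ` (the unit covector as an odd element). [cite: Chern1945, (4)] -/
def Sop (u : Fin d → ℝ) : Op (Fin (d + d)) := ∑ a, u a • χ a

/-- `a_v = ∑ₐ vᵃ ∂/∂χᵃ` (contraction with the unit vector). [folklore] -/
def av (v : Fin d → ℝ) : Op (Fin (d + d)) := ∑ a, v a • anχ a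

/-- `H(N) = ∑_{a,k} N_{ak} θᵏχᵃ` (the covariant differential of the unit field, Chern's `θ_α`/
`ω_{αd}`). [cite: Chern1945, (4)] -/
def Hop (N : Fin d → Fin d → ℝ) : Op (Fin (d + d)) := ∑ a, ∑ k, N a k • z a k

/-- A `θθχ`-element `∑ C_{akl} θᵏθˡχᵃ`. [folklore] -/
def M21 (C : Fin d → Fin d → Fin d → ℝ) : Op (Fin (d + d)) :=
  ∑ a, ∑ k, ∑ l, C a k l • (θ k * θ l * χ a)

/-- A `θθχχ`-element `∑ C_{abkl} θᵏθˡχᵃχᵇ`. [folklore] -/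
def M22 (C : Fin d → Fin d → Fin d → Fin d → ℝ) : Op (Fin (d + d)) :=
  ∑ a, ∑ b, ∑ k, ∑ l, C a b k l • (θ k * θ l * (χ a * χ b))

/-- `Ω̂(R) = ¼ ∑ R_{abkl} θᵏθˡχᵃχᵇ` (curvature element, `= ½Ω_{ab}χᵃχᵇ`).
[cite: Chern1945, (2)] -/
def Ωop (R : Fin d → Fin d → Fin d → Fin d → ℝ) : Op (Fin (d + d)) := (1 / 4 : ℝ) • M22 R

/-- `K(R,v) = -½ ∑ R_{abkl} vᵇ θᵏθˡχᵃ` (`= [a_v, Ω̂]`, Chern's `Ω_{αd}` factor of `Ψₖ`).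
[cite: Chern1945, (5)] -/
def Kop (R : Fin d → Fin d → Fin d → Fin d → ℝ) (v : Fin d → ℝ) : Op (Fin (d + d)) :=
  M21 fun a k l => -(1 / 2 : ℝ) * ∑ b, R a b k l * v b

/-- `Gᵢ = -∑_{a,b} Γᵃᵢ_b χᵇ ∂/∂χᵃ`: the commutator `[Gᵢ, ·]` implements the connection on lower
fibre indices, `[Gᵢ, χᵉ] = -Γᵉᵢₐ χᵃ`. [folklore] -/
def Gop (Γ : Fin d → Fin d → Fin d → ℝ) (i : Fin d) : Op (Fin (d + d)) :=
  -∑ a, ∑ b, Γ a i b • (χ b * anχ a)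

/-- The commutator. [folklore] -/
def comm (X Y : Op (Fin (d + d))) : Op (Fin (d + d)) := X * Y - Y * X

/-- Unfolding of the commutator. [folklore] -/
theorem comm_def (X Y : Op (Fin (d + d))) : comm X Y = X * Y - Y * X := rfl

/-- Leibniz rule for the commutator. [folklore] -/
theorem comm_mul (X Y Z : Op (Fin (d + d))) : comm X (Y * Z) = comm X Y * Z + Y * comm X Z := by
  simp only [comm, mul_sub, sub_mul, mul_assoc]
  abel

/-- The commutator is additive in its second argument. [folklore] -/
theorem comm_add (X Y Z : Op (Fin (d + d))) : comm X (Y + Z) = comm X Y + comm X Z := by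
  simp only [comm, mul_add, add_mul]
  abel

/-- The commutator is homogeneous in its second argument. [folklore] -/
theorem comm_smul (X Y : Op (Fin (d + d))) (c : ℝ) : comm X (c • Y) = c • comm X Y := by
  simp only [comm, mul_smul_comm, smul_mul_assoc, smul_sub]

/-- The commutator commutes with finite sums. [folklore] -/
theorem comm_sum {α : Type*} (s : Finset α) (X : Op (Fin (d + d))) (f : α → Op (Fin (d + d))) :
    comm X (∑ i ∈ s, f i) = ∑ i ∈ s, comm X (f i) := by
  simp only [comm, Finset.mul_sum, Finset.sum_mul, Finset.sum_sub_distrib]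

/-- Commutator with a power of an element commuting with its own commutator. [folklore] -/
theorem comm_pow_of_commute (X Y : Op (Fin (d + d))) (h : Commute Y (comm X Y)) (n : ℕ) :
    comm X (Y ^ (n + 1)) = ((n : ℝ) + 1) • (comm X Y * Y ^ n) := by
  induction n with
  | zero => simp
  | succ n ih =>
    rw [pow_succ, comm_mul, ih, pow_succ]
    have : Y ^ (n + 1) * comm X Y = comm X Y * Y ^ (n + 1) := (h.pow_left (n + 1)).eq
    rw [← pow_succ, this, pow_succ]
    simp only [smul_mul_assoc, mul_assoc, Nat.cast_succ]
    module

/-! ### Membership in `𝒵` and commutation with `θ`, `χ` -/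

/-- The generators lie in `𝒵`. [folklore] -/
theorem z_mem_𝒵 (a k : Fin d) : z a k ∈ 𝒵 d := Algebra.subset_adjoin ⟨(a, k), rfl⟩

/-- `θᵏθˡχᵃχᵇ = -(z a k · z b l)`. [folklore] -/
theorem θθχχ_eq_neg_zz (a b k l : Fin d) : θ k * θ l * (χ a * χ b) = -(z a k * z b l) := by
  have := z_swap a b l k
  -- z a k * z b l = -(θ k θ l χ a χ b) is `z_mul_z_expand`; re-derive from the API
  calc θ k * θ l * (χ a * χ b) = θ k * (θ l * χ a) * χ b := by simp only [mul_assoc]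
    _ = θ k * -(χ a * θ l) * χ b := by rw [θ_mul_χ]
    _ = -(z a k * z b l) := by simp only [z, mul_neg, neg_mul, mul_assoc]

/-- `H(N) ∈ 𝒵`. [folklore] -/
theorem Hop_mem_𝒵 (N : Fin d → Fin d → ℝ) : Hop N ∈ 𝒵 d :=
  Subalgebra.sum_mem _ fun a _ => Subalgebra.sum_mem _ fun k _ =>
    Subalgebra.smul_mem _ (z_mem_𝒵 a k) _

/-- `θθχχ`-elements lie in `𝒵`. [folklore] -/
theorem M22_mem_𝒵 (C : Fin d → Fin d → Fin d → Fin d → ℝ) : M22 C ∈ 𝒵 d :=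
  Subalgebra.sum_mem _ fun a _ => Subalgebra.sum_mem _ fun b _ => Subalgebra.sum_mem _ fun k _ =>
    Subalgebra.sum_mem _ fun l _ => Subalgebra.smul_mem _ (by
      rw [θθχχ_eq_neg_zz]
      exact Subalgebra.neg_mem _ (Subalgebra.mul_mem _ (z_mem_𝒵 a k) (z_mem_𝒵 b l))) _

/-- `Ω̂ ∈ 𝒵`. [folklore] -/
theorem Ωop_mem_𝒵 (R : Fin d → Fin d → Fin d → Fin d → ℝ) : Ωop R ∈ 𝒵 d :=
  Subalgebra.smul_mem _ (M22_mem_𝒵 R) _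

/-- `Hop N` is the image of the linear element `Lh N` of `𝒵`. [folklore] -/
theorem coe_Lh (N : Fin d → Fin d → ℝ) : ((Lh N : 𝒵 d) : Op (Fin (d + d))) = Hop N := by
  simp [Lh, Hop, AddSubmonoidClass.coe_finsetSum]

/-- `θⁱ` commutes with `z a k`. [folklore] -/
theorem θ_mul_z (i a k : Fin d) : θ i * z a k = z a k * θ i := by
  unfold z
  rw [mul_assoc, χ_mul_θ, mul_neg, ← mul_assoc, ← mul_assoc]
  by_cases hik : i = k
  · subst hik
    simp
  · rw [θ_mul_θ hik, neg_mul]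

/-- `χᵇ` commutes with `z a k`. [folklore] -/
theorem χ_mul_z (b a k : Fin d) : χ b * z a k = z a k * χ b := by
  unfold z
  rw [← mul_assoc, χ_mul_θ, neg_mul, mul_assoc, mul_assoc]
  by_cases hab : b = a
  · subst hab
    simp
  · rw [χ_mul_χ hab, mul_neg, neg_neg]

/-- Everything in `𝒵` commutes with every `θⁱ`. [folklore] -/
theorem θ_comm_of_mem_𝒵 {x : Op (Fin (d + d))} (hx : x ∈ 𝒵 d) (i : Fin d) : θ i * x = x * θ i := by
  have h : 𝒵 d ≤ Subalgebra.centralizer ℝ {θ i} := by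
    refine Algebra.adjoin_le ?_
    rintro _ ⟨⟨a, k⟩, rfl⟩
    rw [Subalgebra.coe_centralizer, Set.mem_centralizer_iff]
    intro y hy
    rw [Set.mem_singleton_iff] at hy
    subst hy
    exact θ_mul_z i a k
  have := h hx
  rw [Subalgebra.mem_centralizer_iff] at this
  exact this (θ i) rfl

/-- Everything in `𝒵` commutes with every `χᵃ`. [folklore] -/
theorem χ_comm_of_mem_𝒵 {x : Op (Fin (d + d))} (hx : x ∈ 𝒵 d) (a : Fin d) : χ a * x = x * χ a := by
  have h : 𝒵 d ≤ Subalgebra.centralizer ℝ {χ a} := by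
    refine Algebra.adjoin_le ?_
    rintro _ ⟨⟨b, k⟩, rfl⟩
    rw [Subalgebra.coe_centralizer, Set.mem_centralizer_iff]
    intro y hy
    rw [Set.mem_singleton_iff] at hy
    subst hy
    exact χ_mul_z a b k
  have := h hx
  rw [Subalgebra.mem_centralizer_iff] at this
  exact this (χ a) rfl

/-- `𝒵` commutes with `S`. [folklore] -/
theorem Sop_comm_of_mem_𝒵 {x : Op (Fin (d + d))} (hx : x ∈ 𝒵 d) (u : Fin d → ℝ) :
    Sop u * x = x * Sop u := by
  simp only [Sop, Finset.sum_mul, Finset.mul_sum, smul_mul_assoc, mul_smul_comm,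
    χ_comm_of_mem_𝒵 hx]

/-- `𝒵` commutes with `θθχ`-elements (in particular with `K`). [folklore] -/
theorem M21_comm_of_mem_𝒵 {x : Op (Fin (d + d))} (hx : x ∈ 𝒵 d) (C : Fin d → Fin d → Fin d → ℝ) :
    M21 C * x = x * M21 C := by
  simp only [M21, Finset.sum_mul, Finset.mul_sum, smul_mul_assoc, mul_smul_comm, mul_assoc,
    χ_comm_of_mem_𝒵 hx]
  simp only [← mul_assoc, θ_comm_of_mem_𝒵 hx]

/-- `θⁱ S = -S θⁱ`. [folklore] -/
theorem θ_mul_Sop (i : Fin d) (u : Fin d → ℝ) : θ i * Sop u = -(Sop u * θ i) := by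
  simp only [Sop, Finset.mul_sum, Finset.sum_mul, mul_smul_comm, smul_mul_assoc, θ_mul_χ,
    smul_neg, Finset.sum_neg_distrib]

/-- `θⁱ S = ∑ₐ uₐ z a i`. [folklore] -/
theorem θ_mul_Sop_eq_sum (i : Fin d) (u : Fin d → ℝ) : θ i * Sop u = ∑ a, u a • z a i := by
  simp only [Sop, Finset.mul_sum, mul_smul_comm, z]

/-! ### Canonical (anti)commutation consequences -/

/-- `[Gᵢ, θᵏ] = 0`. [folklore] -/
theorem comm_Gop_θ (Γ : Fin d → Fin d → Fin d → ℝ) (i k : Fin d) : comm (Gop Γ i) (θ k) = 0 := by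
  simp only [comm, Gop, neg_mul, mul_neg, Finset.sum_mul, Finset.mul_sum, smul_mul_assoc,
    mul_smul_comm, mul_assoc, anχ_mul_θ, mul_neg, smul_neg, Finset.sum_neg_distrib, neg_neg]
  simp only [← mul_assoc, χ_mul_θ, neg_mul, smul_neg, Finset.sum_neg_distrib]
  abel

/-- `Gᵢ` commutes with `θᵏ`. [folklore] -/
theorem Gop_mul_θ (Γ : Fin d → Fin d → Fin d → ℝ) (i k : Fin d) :
    Gop Γ i * θ k = θ k * Gop Γ i :=
  sub_eq_zero.mp (comm_Gop_θ Γ i k)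

/-- `[Gᵢ, χᵉ] = -∑ₐ Γᵉᵢₐ χᵃ`: the connection acting on a lower fibre index. [folklore] -/
theorem comm_Gop_χ (Γ : Fin d → Fin d → Fin d → ℝ) (i e : Fin d) :
    comm (Gop Γ i) (χ e) = -∑ a, Γ e i a • χ a := by
  have key : ∀ a b : Fin d, χ b * anχ a * χ e - χ e * (χ b * anχ a) =
      if a = e then χ b else 0 := by
    intro a b
    have h1 : anχ a * χ e = (if a = e then 1 else 0) - χ e * anχ a :=
      eq_sub_of_add_eq (anχ_mul_χ_add a e)
    rw [mul_assoc, h1, mul_sub, ← mul_assoc, ← mul_assoc]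
    by_cases hbe : b = e
    · subst hbe
      simp only [χ_mul_self, zero_mul, sub_zero]
      split_ifs <;> simp
    · rw [χ_mul_χ (Ne.symm hbe)]
      split_ifs <;> simp
  have : comm (Gop Γ i) (χ e) = -∑ a, ∑ b, Γ a i b • (χ b * anχ a * χ e - χ e * (χ b * anχ a)) := by
    simp only [comm, Gop, neg_mul, mul_neg, sub_neg_eq_add, Finset.sum_mul, Finset.mul_sum,
      smul_mul_assoc, mul_smul_comm, smul_sub, Finset.sum_sub_distrib, neg_sub]
    abel
  rw [this]
  simp_rw [key]
  rw [Finset.sum_comm]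
  simp only [smul_ite, smul_zero, Finset.sum_ite_eq', Finset.mem_univ, if_true]


/-- Reordering a triple sum (outer ↔ inner). [folklore] -/
theorem sum_comm3 {M : Type*} [AddCommMonoid M] {α β γ : Type*} [Fintype α] [Fintype β]
    [Fintype γ] (f : α → β → γ → M) :
    ∑ a, ∑ b, ∑ c, f a b c = ∑ c, ∑ b, ∑ a, f a b c := by
  rw [Finset.sum_comm]
  refine (Finset.sum_congr rfl fun b _ => Finset.sum_comm).trans ?_
  rw [Finset.sum_comm]

/-- Reordering a quadruple sum (1st ↔ 4th). [folklore] -/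
theorem sum_swap14 {M : Type*} [AddCommMonoid M] {α : Type*} [Fintype α] (f : α → α → α → α → M) :
    ∑ a, ∑ b, ∑ c, ∑ e, f a b c e = ∑ e, ∑ b, ∑ c, ∑ a, f a b c e := by
  calc ∑ a, ∑ b, ∑ c, ∑ e, f a b c e = ∑ a, ∑ e, ∑ c, ∑ b, f a b c e :=
        Finset.sum_congr rfl fun a _ => sum_comm3 _
    _ = ∑ e, ∑ a, ∑ c, ∑ b, f a b c e := Finset.sum_comm
    _ = ∑ e, ∑ b, ∑ c, ∑ a, f a b c e := Finset.sum_congr rfl fun e _ => sum_comm3 _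

/-- Reordering a quintuple sum (1st ↔ 5th). [folklore] -/
theorem sum_swap15 {M : Type*} [AddCommMonoid M] {α : Type*} [Fintype α]
    (f : α → α → α → α → α → M) :
    ∑ a, ∑ b, ∑ c, ∑ l, ∑ e, f a b c l e = ∑ e, ∑ b, ∑ c, ∑ l, ∑ a, f a b c l e := by
  calc ∑ a, ∑ b, ∑ c, ∑ l, ∑ e, f a b c l e = ∑ a, ∑ b, ∑ e, ∑ l, ∑ c, f a b c l e :=
        Finset.sum_congr rfl fun a _ => Finset.sum_congr rfl fun b _ => sum_comm3 _
    _ = ∑ e, ∑ b, ∑ a, ∑ l, ∑ c, f a b c l e := sum_comm3 _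
    _ = ∑ e, ∑ b, ∑ c, ∑ l, ∑ a, f a b c l e :=
        Finset.sum_congr rfl fun e _ => Finset.sum_congr rfl fun b _ => sum_comm3 _

/-- `[Gᵢ, z a k] = -∑ₑ Γᵃᵢₑ z e k`. [folklore] -/
theorem comm_Gop_z (Γ : Fin d → Fin d → Fin d → ℝ) (i a k : Fin d) :
    comm (Gop Γ i) (z a k) = -∑ e, Γ a i e • z e k := by
  rw [z, comm_mul, comm_Gop_θ, zero_mul, zero_add, comm_Gop_χ, mul_neg, Finset.mul_sum]
  simp only [mul_smul_comm, z]

/-- `[Gᵢ, H(N)] = H(N')` with `N'_{ek} = -∑ₐ Γᵃᵢₑ N_{ak}`. [folklore] -/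
theorem comm_Gop_Hop (Γ : Fin d → Fin d → Fin d → ℝ) (i : Fin d) (N : Fin d → Fin d → ℝ) :
    comm (Gop Γ i) (Hop N) = Hop fun e k => -∑ a, Γ a i e * N a k := by
  simp only [Hop, comm_sum, comm_smul, comm_Gop_z, smul_neg, Finset.smul_sum, smul_smul,
    neg_smul, Finset.sum_smul, Finset.sum_neg_distrib]
  rw [sum_comm3]
  congr 1
  refine Finset.sum_congr rfl fun e _ => Finset.sum_congr rfl fun k _ =>
    Finset.sum_congr rfl fun a _ => ?_
  rw [mul_comm]

/-- `[Gᵢ, S(u)] = S(u')` with `u'ₐ = -∑ₑ Γᵉᵢₐ uₑ`. [folklore] -/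
theorem comm_Gop_Sop (Γ : Fin d → Fin d → Fin d → ℝ) (i : Fin d) (u : Fin d → ℝ) :
    comm (Gop Γ i) (Sop u) = Sop fun a => -∑ e, Γ e i a * u e := by
  simp only [Sop, comm_sum, comm_smul, comm_Gop_χ, smul_neg, Finset.smul_sum, smul_smul,
    neg_smul, Finset.sum_smul, Finset.sum_neg_distrib]
  rw [Finset.sum_comm]
  congr 1
  refine Finset.sum_congr rfl fun a _ => Finset.sum_congr rfl fun e _ => ?_
  rw [mul_comm]

/-- `Gᵢ` commutes with `θᵏθˡ`. [folklore] -/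
theorem comm_Gop_θθ_mul (Γ : Fin d → Fin d → Fin d → ℝ) (i k l : Fin d) (X : Op (Fin (d + d))) :
    comm (Gop Γ i) (θ k * θ l * X) = θ k * θ l * comm (Gop Γ i) X := by
  rw [comm_mul, comm_mul, comm_Gop_θ, comm_Gop_θ]
  simp

/-- `[Gᵢ, χᵃχᵇ]`. [folklore] -/
theorem comm_Gop_χχ (Γ : Fin d → Fin d → Fin d → ℝ) (i a b : Fin d) :
    comm (Gop Γ i) (χ a * χ b) = -∑ e, Γ a i e • (χ e * χ b) - ∑ e, Γ b i e • (χ a * χ e) := by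
  rw [comm_mul, comm_Gop_χ, comm_Gop_χ]
  simp only [neg_mul, Finset.sum_mul, smul_mul_assoc, mul_neg, Finset.mul_sum, mul_smul_comm]
  abel

/-- `[Gᵢ, M22 C]` is again a `θθχχ`-element, with the connection acting on both fibre indices.
[folklore] -/
theorem comm_Gop_M22 (Γ : Fin d → Fin d → Fin d → ℝ) (i : Fin d)
    (C : Fin d → Fin d → Fin d → Fin d → ℝ) :
    comm (Gop Γ i) (M22 C) =
      M22 fun a b k l => -∑ e, (C e b k l * Γ e i a + C a e k l * Γ e i b) := by
  -- expand the left-hand side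
  have lhs : comm (Gop Γ i) (M22 C) =
      -(∑ a, ∑ b, ∑ k, ∑ l, ∑ e, (C a b k l * Γ a i e) • (θ k * θ l * (χ e * χ b))) -
        ∑ a, ∑ b, ∑ k, ∑ l, ∑ e, (C a b k l * Γ b i e) • (θ k * θ l * (χ a * χ e)) := by
    simp only [M22, comm_sum, comm_smul, comm_Gop_θθ_mul, comm_Gop_χχ, mul_sub, mul_neg,
      Finset.mul_sum, mul_smul_comm, smul_sub, smul_neg, Finset.smul_sum, smul_smul,
      Finset.sum_neg_distrib, Finset.sum_sub_distrib]
  -- expand the right-hand side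
  have rhs : M22 (fun a b k l => -∑ e, (C e b k l * Γ e i a + C a e k l * Γ e i b)) =
      -(∑ a, ∑ b, ∑ k, ∑ l, ∑ e, (C e b k l * Γ e i a) • (θ k * θ l * (χ a * χ b))) -
        ∑ a, ∑ b, ∑ k, ∑ l, ∑ e, (C a e k l * Γ e i b) • (θ k * θ l * (χ a * χ b)) := by
    simp only [M22, neg_smul, Finset.sum_smul, add_smul, Finset.sum_add_distrib,
      Finset.sum_neg_distrib, neg_add, sub_eq_add_neg]
  have hX : (∑ a, ∑ b, ∑ k, ∑ l, ∑ e, (C a b k l * Γ a i e) • (θ k * θ l * (χ e * χ b))) =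
      ∑ a, ∑ b, ∑ k, ∑ l, ∑ e, (C e b k l * Γ e i a) • (θ k * θ l * (χ a * χ b)) :=
    sum_swap15 _
  have hY : (∑ a, ∑ b, ∑ k, ∑ l, ∑ e, (C a b k l * Γ b i e) • (θ k * θ l * (χ a * χ e))) =
      ∑ a, ∑ b, ∑ k, ∑ l, ∑ e, (C a e k l * Γ e i b) • (θ k * θ l * (χ a * χ b)) :=
    Finset.sum_congr rfl fun a _ => sum_swap14 _
  rw [lhs, rhs, hX, hY]


/-! ### Linearity of the structure elements in their coefficients -/

/-- Additivity of `Sop`. [folklore] -/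
theorem Sop_add (u u' : Fin d → ℝ) : Sop (u + u') = Sop u + Sop u' := by
  simp [Sop, add_smul, Finset.sum_add_distrib]

/-- Additivity of `Sop` (pointwise form). [folklore] -/
theorem Sop_add' (u u' : Fin d → ℝ) : Sop (fun a => u a + u' a) = Sop u + Sop u' := Sop_add u u'

/-- Additivity of `Hop` (pointwise form). [folklore] -/
theorem Hop_add' (N N' : Fin d → Fin d → ℝ) : Hop (fun a k => N a k + N' a k) = Hop N + Hop N' := by
  simp [Hop, add_smul, Finset.sum_add_distrib]

/-- Additivity of `M21`. [folklore] -/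
theorem M21_add' (C C' : Fin d → Fin d → Fin d → ℝ) :
    M21 (fun a k l => C a k l + C' a k l) = M21 C + M21 C' := by
  simp [M21, add_smul, Finset.sum_add_distrib]

/-- Homogeneity of `M21`. [folklore] -/
theorem M21_smul' (c : ℝ) (C : Fin d → Fin d → Fin d → ℝ) :
    M21 (fun a k l => c * C a k l) = c • M21 C := by
  simp [M21, Finset.smul_sum, smul_smul]

/-- `M21` of a negated array. [folklore] -/
theorem M21_neg' (C : Fin d → Fin d → Fin d → ℝ) : M21 (fun a k l => -C a k l) = -M21 C := by
  simp [M21, Finset.sum_neg_distrib]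

/-- Additivity of `M22`. [folklore] -/
theorem M22_add' (C C' : Fin d → Fin d → Fin d → Fin d → ℝ) :
    M22 (fun a b k l => C a b k l + C' a b k l) = M22 C + M22 C' := by
  simp [M22, add_smul, Finset.sum_add_distrib]

/-- Additivity of `Ωop`. [folklore] -/
theorem Ωop_add' (R R' : Fin d → Fin d → Fin d → Fin d → ℝ) :
    Ωop (fun a b k l => R a b k l + R' a b k l) = Ωop R + Ωop R' := by
  rw [Ωop, Ωop, Ωop, M22_add', smul_add]

/-- Two elements of `𝒵` commute. [folklore] -/
theorem mul_comm_of_mem_𝒵 {x y : Op (Fin (d + d))} (hx : x ∈ 𝒵 d) (hy : y ∈ 𝒵 d) :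
    x * y = y * x :=
  congrArg Subtype.val (mul_comm (⟨x, hx⟩ : 𝒵 d) ⟨y, hy⟩)

/-! ### The contraction `a_v` -/

/-- `a_v χᵃ = vᵃ - χᵃ a_v`. [folklore] -/
theorem av_mul_χ (v : Fin d → ℝ) (a : Fin d) : av v * χ a = v a • (1 : Op (Fin (d + d))) - χ a * av v := by
  have h : ∀ c, anχ c * χ a = (if c = a then 1 else 0) - χ a * anχ c :=
    fun c => eq_sub_of_add_eq (anχ_mul_χ_add c a)
  simp only [av, Finset.sum_mul, smul_mul_assoc, h, smul_sub, Finset.sum_sub_distrib, smul_ite,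
    smul_zero, Finset.sum_ite_eq', Finset.mem_univ, if_true, Finset.mul_sum, mul_smul_comm]

/-- `a_v θᵏ = -θᵏ a_v`. [folklore] -/
theorem av_mul_θ (v : Fin d → ℝ) (k : Fin d) : av v * θ k = -(θ k * av v) := by
  simp only [av, Finset.sum_mul, smul_mul_assoc, anχ_mul_θ, smul_neg, Finset.sum_neg_distrib,
    Finset.mul_sum, mul_smul_comm]

/-- `a_v S = (v·u) - S a_v`. [folklore] -/
theorem av_mul_Sop (v u : Fin d → ℝ) :
    av v * Sop u = (∑ a, v a * u a) • (1 : Op (Fin (d + d))) - Sop u * av v := by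
  simp only [Sop, Finset.mul_sum, mul_smul_comm, av_mul_χ, smul_sub, smul_smul,
    Finset.sum_sub_distrib, Finset.sum_smul, Finset.sum_mul, smul_mul_assoc, mul_comm (u _) (v _)]

/-- `[a_v, z a k] = -vᵃ θᵏ`. [folklore] -/
theorem comm_av_z (v : Fin d → ℝ) (a k : Fin d) : comm (av v) (z a k) = -(v a • θ k) := by
  rw [comm, z, ← mul_assoc, av_mul_θ, neg_mul, mul_assoc, av_mul_χ, mul_sub, ← mul_assoc]
  simp

/-- `[a_v, H(N)] = -∑ₖ (v·N_{·k}) θᵏ`. [folklore] -/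
theorem comm_av_Hop (v : Fin d → ℝ) (N : Fin d → Fin d → ℝ) :
    comm (av v) (Hop N) = -∑ k, (∑ a, v a * N a k) • θ k := by
  simp only [Hop, comm_sum, comm_smul, comm_av_z, smul_neg, smul_smul, Finset.sum_neg_distrib,
    Finset.sum_smul, mul_comm (N _ _) (v _)]
  rw [Finset.sum_comm]

/-- `a_v` passes through `θᵏθˡ`. [folklore] -/
theorem comm_av_θθ_mul (v : Fin d → ℝ) (k l : Fin d) (X : Op (Fin (d + d))) :
    comm (av v) (θ k * θ l * X) = θ k * θ l * comm (av v) X := by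
  have key : av v * (θ k * θ l * X) = θ k * θ l * (av v * X) := by
    rw [← mul_assoc, ← mul_assoc, av_mul_θ, neg_mul, mul_assoc (θ k) (av v) (θ l), av_mul_θ]
    simp only [mul_neg, neg_neg, mul_assoc]
  rw [comm, comm, key, mul_sub, mul_assoc (θ k * θ l) X (av v)]

/-- `[a_v, χᵃχᵇ] = vᵃχᵇ - vᵇχᵃ`. [folklore] -/
theorem comm_av_χχ (v : Fin d → ℝ) (a b : Fin d) :
    comm (av v) (χ a * χ b) = v a • χ b - v b • χ a := by
  rw [comm, ← mul_assoc, av_mul_χ, sub_mul, mul_assoc, av_mul_χ]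
  simp only [smul_mul_assoc, one_mul, mul_sub, mul_smul_comm, mul_one, ← mul_assoc]
  abel

/-- `[a_v, M22 C]`. [folklore] -/
theorem comm_av_M22 (v : Fin d → ℝ) (C : Fin d → Fin d → Fin d → Fin d → ℝ) :
    comm (av v) (M22 C) =
      (∑ a, ∑ b, ∑ k, ∑ l, (C a b k l * v a) • (θ k * θ l * χ b)) -
        ∑ a, ∑ b, ∑ k, ∑ l, (C a b k l * v b) • (θ k * θ l * χ a) := by
  simp only [M22, comm_sum, comm_smul, comm_av_θθ_mul, comm_av_χχ, mul_sub, mul_smul_comm,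
    smul_sub, smul_smul, Finset.sum_sub_distrib]

/-- `[a_v, Ω̂] = K` (uses the skew-symmetry of `R` in its first two indices). [cite: Chern1945, (5)] -/
theorem comm_av_Ωop (v : Fin d → ℝ) (R : Fin d → Fin d → Fin d → Fin d → ℝ)
    (hR : ∀ a b k l, R a b k l = -R b a k l) : comm (av v) (Ωop R) = Kop R v := by
  have h1 : (∑ a, ∑ b, ∑ k, ∑ l, (R a b k l * v a) • (θ k * θ l * χ b)) =
      -∑ a, ∑ b, ∑ k, ∑ l, (R a b k l * v b) • (θ k * θ l * χ a) := by
    calc (∑ a, ∑ b, ∑ k, ∑ l, (R a b k l * v a) • (θ k * θ l * χ b))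
        = ∑ b, ∑ a, ∑ k, ∑ l, (R a b k l * v a) • (θ k * θ l * χ b) := Finset.sum_comm
      _ = ∑ b, ∑ a, ∑ k, ∑ l, -((R b a k l * v a) • (θ k * θ l * χ b)) := by
          refine Finset.sum_congr rfl fun b _ => Finset.sum_congr rfl fun a _ =>
            Finset.sum_congr rfl fun k _ => Finset.sum_congr rfl fun l _ => ?_
          rw [hR a b k l, neg_mul, neg_smul]
      _ = _ := by simp only [Finset.sum_neg_distrib]
  have h2 : (∑ a, ∑ b, ∑ k, ∑ l, (R a b k l * v b) • (θ k * θ l * χ a)) =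
      M21 (fun a k l => ∑ b, R a b k l * v b) := by
    simp only [M21, Finset.sum_smul]
    refine Finset.sum_congr rfl fun a _ => ?_
    calc (∑ b, ∑ k, ∑ l, (R a b k l * v b) • (θ k * θ l * χ a))
        = ∑ k, ∑ b, ∑ l, (R a b k l * v b) • (θ k * θ l * χ a) := Finset.sum_comm
      _ = _ := Finset.sum_congr rfl fun k _ => Finset.sum_comm
  rw [Ωop, comm_smul, comm_av_M22, h1, h2, Kop, M21_smul']
  set X := M21 (fun a k l => ∑ b, R a b k l * v b)
  rw [show -X - X = (-2 : ℝ) • X by rw [neg_smul, two_smul]; abel, smul_smul]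
  norm_num

/-! ### Berezin integral against `a_v` and `Gᵢ` -/

/-- `top (a_v Y) = 0`. [folklore] -/
@[simp]
theorem top_av_mul (v : Fin d → ℝ) (Y : Op (Fin (d + d))) : top (av v * Y) = 0 := by
  simp [av, Finset.sum_mul]

/-- `top (Y a_v) = 0`. [folklore] -/
@[simp]
theorem top_mul_av (Y : Op (Fin (d + d))) (v : Fin d → ℝ) : top (Y * av v) = 0 := by
  simp [av, Finset.mul_sum]

/-- `top (Y Gᵢ) = 0`. [folklore] -/
@[simp]
theorem top_mul_Gop (Y : Op (Fin (d + d))) (Γ : Fin d → Fin d → Fin d → ℝ) (i : Fin d) :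
    top (Y * Gop Γ i) = 0 := by
  simp [Gop, Finset.mul_sum, ← mul_assoc]

/-- The trace identity `top (θⁱ Gᵢ Y) = -(∑ₐ Γᵃᵢₐ) top (θⁱ Y)`. [folklore] -/
theorem top_θ_Gop_mul (Γ : Fin d → Fin d → Fin d → ℝ) (i : Fin d) (Y : Op (Fin (d + d))) :
    top (θ i * Gop Γ i * Y) = -(∑ a, Γ a i a) * top (θ i * Y) := by
  simp only [Gop, mul_neg, Finset.mul_sum, mul_smul_comm, neg_mul, Finset.sum_mul, smul_mul_assoc,
    map_neg, map_sum, map_smul, ← mul_assoc, top_θ_mul_χ_mul_anχ_mul, smul_eq_mul, mul_ite,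
    mul_zero, Finset.sum_ite_eq, Finset.mem_univ, if_true]

/-- `top (θⁱ [Gᵢ, Y]) = -(∑ₐ Γᵃᵢₐ) top (θⁱ Y)`. [folklore] -/
theorem top_θ_comm_Gop (Γ : Fin d → Fin d → Fin d → ℝ) (i : Fin d) (Y : Op (Fin (d + d))) :
    top (θ i * comm (Gop Γ i) Y) = -(∑ a, Γ a i a) * top (θ i * Y) := by
  rw [comm, mul_sub, map_sub, ← mul_assoc, ← mul_assoc, top_θ_Gop_mul, top_mul_Gop, sub_zero]

/-! ### Cyclic symmetry of `θθθ` and the two vanishing lemmas -/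

/-- `θᵏθˡθᵐ = θᵐθᵏθˡ`. [folklore] -/
theorem θ_cyclic (k l m : Fin d) : θ k * θ l * θ m = θ m * θ k * θ l := by
  by_cases hlm : l = m
  · subst hlm
    rw [mul_assoc, θ_mul_self, mul_zero]
    by_cases hkl : k = l
    · subst hkl
      simp
    · rw [θ_mul_θ (Ne.symm hkl), neg_mul, mul_assoc, θ_mul_self, mul_zero, neg_zero]
  · by_cases hkm : k = m
    · subst hkm
      rw [mul_assoc, θ_mul_θ hlm, mul_neg, ← mul_assoc, θ_mul_self, zero_mul, neg_zero]
    · rw [mul_assoc, θ_mul_θ hlm, mul_neg, ← mul_assoc, θ_mul_θ hkm, neg_mul, neg_neg]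

/-- A `θθθ`-sum with cyclically vanishing coefficients is zero (used with the second Bianchi
identity). [folklore] -/
theorem sum_θθθ_eq_zero_of_cyclic (C : Fin d → Fin d → Fin d → ℝ)
    (h : ∀ m k l, C m k l + C k l m + C l m k = 0) :
    ∑ m, ∑ k, ∑ l, C m k l • (θ m * θ k * θ l) = 0 := by
  set T := ∑ m, ∑ k, ∑ l, C m k l • (θ m * θ k * θ l) with hT
  -- the two cyclic reorderings of the summation
  have h1 : T = ∑ m, ∑ k, ∑ l, C l m k • (θ m * θ k * θ l) := by
    calc T = ∑ b, ∑ a, ∑ c, C a b c • (θ a * θ b * θ c) := Finset.sum_comm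
      _ = ∑ b, ∑ c, ∑ a, C a b c • (θ a * θ b * θ c) :=
          Finset.sum_congr rfl fun b _ => Finset.sum_comm
      _ = ∑ b, ∑ c, ∑ a, C a b c • (θ b * θ c * θ a) := by
          refine Finset.sum_congr rfl fun b _ => Finset.sum_congr rfl fun c _ =>
            Finset.sum_congr rfl fun a _ => ?_
          rw [θ_cyclic b c a]
  have h2 : T = ∑ m, ∑ k, ∑ l, C k l m • (θ m * θ k * θ l) := by
    calc T = ∑ a, ∑ c, ∑ b, C a b c • (θ a * θ b * θ c) :=
          Finset.sum_congr rfl fun a _ => Finset.sum_comm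
      _ = ∑ c, ∑ a, ∑ b, C a b c • (θ a * θ b * θ c) := Finset.sum_comm
      _ = ∑ c, ∑ a, ∑ b, C a b c • (θ c * θ a * θ b) := by
          refine Finset.sum_congr rfl fun c _ => Finset.sum_congr rfl fun a _ =>
            Finset.sum_congr rfl fun b _ => ?_
          rw [θ_cyclic a b c]
  have h3 : (3 : ℝ) • T = 0 := by
    rw [show (3 : ℝ) • T = T + T + T by
      rw [show (3 : ℝ) = 1 + 1 + 1 by norm_num, add_smul, add_smul, one_smul]]
    nth_rewrite 2 [h2]
    nth_rewrite 2 [h1]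
    rw [hT]
    simp only [← Finset.sum_add_distrib, ← add_smul, h, zero_smul, Finset.sum_const_zero]
  exact (smul_eq_zero.mp h3).resolve_left (by norm_num)

/-- `M21` of a difference of arrays. [folklore] -/
theorem M21_sub' (C C' : Fin d → Fin d → Fin d → ℝ) :
    M21 (fun a k l => C a k l - C' a k l) = M21 C - M21 C' := by
  simp [M21, sub_smul, Finset.sum_sub_distrib]

/-- Antisymmetrisation of a `θθχ`-element in its two form indices. [folklore] -/
theorem M21_eq_antisymm (C : Fin d → Fin d → Fin d → ℝ) :
    M21 C = M21 fun a k l => (1 / 2 : ℝ) * (C a k l - C a l k) := by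
  have hswap : M21 (fun a k l => C a l k) = -M21 C := by
    calc M21 (fun a k l => C a l k) = ∑ a, ∑ k, ∑ l, C a l k • (θ k * θ l * χ a) := rfl
      _ = ∑ a, ∑ l, ∑ k, C a l k • (θ k * θ l * χ a) :=
          Finset.sum_congr rfl fun a _ => Finset.sum_comm
      _ = ∑ a, ∑ k, ∑ l, -(C a k l • (θ k * θ l * χ a)) := by
          refine Finset.sum_congr rfl fun a _ => Finset.sum_congr rfl fun k _ =>
            Finset.sum_congr rfl fun l _ => ?_
          by_cases hkl : k = l
          · subst hkl
            simp
          · rw [θ_mul_θ (Ne.symm hkl), neg_mul, smul_neg]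
      _ = -M21 C := by simp only [Finset.sum_neg_distrib, M21]
  rw [M21_smul', M21_sub', hswap, sub_neg_eq_add, ← two_smul ℝ (M21 C), smul_smul]
  norm_num


/-! ### The three covariant differentials: `∇S = H`, `∇H = -K`, `∇Ω̂ = 0` -/

section Structure

variable (u v : Fin d → ℝ) (N : Fin d → Fin d → ℝ) (R : Fin d → Fin d → Fin d → Fin d → ℝ)
  (Γ : Fin d → Fin d → Fin d → ℝ) (δu : Fin d → Fin d → ℝ) (δN : Fin d → Fin d → Fin d → ℝ)
  (δR : Fin d → Fin d → Fin d → Fin d → Fin d → ℝ)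

/-- The coefficient array of `∇Ω̂`: `C_{ab}(m,k,l) = ∂ₘR_{abkl} - ∑ₑ (Γᵉₘₐ R_{ebkl} + Γᵉₘ_b R_{aekl})`
(the `θᵐθᵏθˡχᵃχᵇ`-coefficient of the covariant exterior derivative of the curvature).
[cite: Chern1945, (3)] -/
def bianchiC (a b m k l : Fin d) : ℝ :=
  δR a b k l m - ∑ e, (R e b k l * Γ e m a + R a e k l * Γ e m b)

/-- **`∇S = H`**: from metric compatibility (S1) `∂ᵢuₐ = N_{ai} + Γᵇᵢₐ u_b`. [cite: Chern1945, (4)] -/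
theorem nablaS (hS1 : ∀ a i, δu a i = N a i + ∑ b, Γ b i a * u b) :
    ∑ i, θ i * (Sop (fun a => δu a i) + comm (Gop Γ i) (Sop u)) = Hop N := by
  have h : ∀ i, Sop (fun a => δu a i) + comm (Gop Γ i) (Sop u) = Sop (fun a => N a i) := by
    intro i
    rw [comm_Gop_Sop, ← Sop_add']
    have hf : (fun a => δu a i + -∑ e, Γ e i a * u e) = fun a => N a i := by
      funext a
      rw [hS1]
      ring
    rw [hf]
  rw [Finset.sum_congr rfl fun i _ => by rw [h]]
  simp only [θ_mul_Sop_eq_sum, Hop]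
  exact Finset.sum_comm

/-- **`∇H = -K`**: from the structure equation (S2)
`∂ᵢN_{ak} - ∂ₖN_{ai} = R_{acik}vᶜ + Γᵇᵢₐ N_{bk} - Γᵇₖₐ N_{bi}`. [cite: Chern1945, (5)] -/
theorem nablaH (hS2 : ∀ a i k, δN a k i - δN a i k =
      (∑ c, R a c i k * v c) + ∑ b, (Γ b i a * N b k - Γ b k a * N b i)) :
    ∑ i, θ i * (Hop (fun a k => δN a k i) + comm (Gop Γ i) (Hop N)) = -Kop R v := by
  have h1 : ∀ i, Hop (fun a k => δN a k i) + comm (Gop Γ i) (Hop N) =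
      Hop (fun a k => δN a k i + -∑ e, Γ e i a * N e k) := by
    intro i
    rw [comm_Gop_Hop, ← Hop_add']
  have h2 : ∑ i, θ i * Hop (fun a k => δN a k i + -∑ e, Γ e i a * N e k) =
      M21 (fun a i k => δN a k i + -∑ e, Γ e i a * N e k) := by
    simp only [Hop, Finset.mul_sum, mul_smul_comm, z, ← mul_assoc, M21]
    exact Finset.sum_comm
  rw [Finset.sum_congr rfl fun i _ => by rw [h1], h2, M21_eq_antisymm]
  have h3 : (fun a k l => (1 / 2 : ℝ) * (δN a l k + -∑ e, Γ e k a * N e l -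
      (δN a k l + -∑ e, Γ e l a * N e k))) = fun a k l => -(-(1 / 2 : ℝ) * ∑ c, R a c k l * v c) := by
    funext a k l
    have := hS2 a k l
    rw [Finset.sum_sub_distrib] at this
    linarith
  rw [h3, M21_neg', Kop]

/-- **`∇Ω̂ = 0`**: from the second Bianchi identity (S3), stated as the vanishing of the cyclic
sums of `bianchiC`. [cite: Chern1945, (3)] -/
theorem nablaΩ (hS3 : ∀ a b m k l, bianchiC R Γ δR a b m k l + bianchiC R Γ δR a b k l m +
      bianchiC R Γ δR a b l m k = 0) :
    ∑ m, θ m * (Ωop (fun a b k l => δR a b k l m) + comm (Gop Γ m) (Ωop R)) = 0 := by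
  have h1 : ∀ m, Ωop (fun a b k l => δR a b k l m) + comm (Gop Γ m) (Ωop R) =
      (1 / 4 : ℝ) • M22 (fun a b k l => bianchiC R Γ δR a b m k l) := by
    intro m
    rw [Ωop, Ωop, comm_smul, comm_Gop_M22, ← smul_add, ← M22_add']
    have hf : (fun a b k l => δR a b k l m + -∑ e, (R e b k l * Γ e m a + R a e k l * Γ e m b)) =
        fun a b k l => bianchiC R Γ δR a b m k l := by
      funext a b k l
      rw [bianchiC, sub_eq_add_neg]
    rw [hf]
  rw [Finset.sum_congr rfl fun m _ => by rw [h1]]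
  have h2 : ∑ m, θ m * ((1 / 4 : ℝ) • M22 (fun a b k l => bianchiC R Γ δR a b m k l)) =
      (1 / 4 : ℝ) • ∑ a, ∑ b, (∑ m, ∑ k, ∑ l, bianchiC R Γ δR a b m k l • (θ m * θ k * θ l)) *
        (χ a * χ b) := by
    simp only [mul_smul_comm, ← Finset.smul_sum, M22, Finset.mul_sum, ← mul_assoc, Finset.sum_mul,
      smul_mul_assoc]
    have hsum : (∑ m, ∑ a, ∑ b, ∑ k, ∑ l,
        bianchiC R Γ δR a b m k l • (θ m * θ k * θ l * χ a * χ b)) =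
        ∑ a, ∑ b, ∑ m, ∑ k, ∑ l, bianchiC R Γ δR a b m k l • (θ m * θ k * θ l * χ a * χ b) := by
      calc (∑ m, ∑ a, ∑ b, ∑ k, ∑ l, bianchiC R Γ δR a b m k l • (θ m * θ k * θ l * χ a * χ b))
          = ∑ a, ∑ m, ∑ b, ∑ k, ∑ l, bianchiC R Γ δR a b m k l • (θ m * θ k * θ l * χ a * χ b) :=
            Finset.sum_comm
        _ = _ := Finset.sum_congr rfl fun a _ => Finset.sum_comm
    rw [hsum]
  rw [h2]
  have h3 : ∀ a b, ∑ m, ∑ k, ∑ l, bianchiC R Γ δR a b m k l • (θ m * θ k * θ l) = 0 :=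
    fun a b => sum_θθθ_eq_zero_of_cyclic _ (hS3 a b)
  simp only [h3, zero_mul, Finset.sum_const_zero, smul_zero]


/-! ### Chern's two identities `(★1)`, `(★2)` -/

/-- Commutator with a power, all cases of the exponent. [folklore] -/
theorem comm_pow' (X Y : Op (Fin (d + d))) (h : Commute Y (comm X Y)) (n : ℕ) :
    comm X (Y ^ n) = (n : ℝ) • (comm X Y * Y ^ (n - 1)) := by
  cases n with
  | zero => simp [comm]
  | succ n => rw [comm_pow_of_commute X Y h n, Nat.cast_succ, Nat.add_sub_cancel]

/-- **(★1)** `top (Hʲ Ω̂ᵐ) = m · top (S K Hʲ Ω̂ᵐ⁻¹)`: the Berezin integral of an `a_v`-exact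
element vanishes; expand `a_v (S Hʲ Ω̂ᵐ)` using `a_v S + S a_v = v·u = 1`, `[a_v, H] = 0`
(`v·N = 0`) and `[a_v, Ω̂] = K`. This is the algebraic identity behind Chern's
`Ψ_k`-recursion. [cite: Chern1945, (6)] -/
theorem top_Hpow_Ωpow (hA1 : ∑ a, v a * u a = 1) (hA2 : ∀ k, ∑ a, v a * N a k = 0)
    (hA3 : ∀ a b k l, R a b k l = -R b a k l) (j m : ℕ) :
    top (Hop N ^ j * Ωop R ^ m) =
      (m : ℝ) * top (Sop u * Kop R v * Hop N ^ j * Ωop R ^ (m - 1)) := by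
  -- `[a_v, Hʲ] = 0`
  have hH : comm (av v) (Hop N) = 0 := by
    rw [comm_av_Hop]
    simp [hA2]
  have hHj : comm (av v) (Hop N ^ j) = 0 := by
    rw [comm_pow' _ _ (by rw [hH]; exact Commute.zero_right _), hH, zero_mul, smul_zero]
  -- `[a_v, Ω̂ᵐ] = m K Ω̂ᵐ⁻¹`
  have hΩ : comm (av v) (Ωop R) = Kop R v := comm_av_Ωop v R hA3
  have hΩK : Commute (Ωop R) (Kop R v) := (M21_comm_of_mem_𝒵 (Ωop_mem_𝒵 R) _).symm
  have hΩm : comm (av v) (Ωop R ^ m) = (m : ℝ) • (Kop R v * Ωop R ^ (m - 1)) := by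
    rw [comm_pow' _ _ (by rw [hΩ]; exact hΩK), hΩ]
  -- `a_v (Hʲ Ω̂ᵐ) = Hʲ Ω̂ᵐ a_v + m Hʲ K Ω̂ᵐ⁻¹`
  have e2 : av v * (Hop N ^ j * Ωop R ^ m) =
      Hop N ^ j * Ωop R ^ m * av v + (m : ℝ) • (Hop N ^ j * (Kop R v * Ωop R ^ (m - 1))) := by
    have : comm (av v) (Hop N ^ j * Ωop R ^ m) =
        (m : ℝ) • (Hop N ^ j * (Kop R v * Ωop R ^ (m - 1))) := by
      rw [comm_mul, hHj, zero_mul, zero_add, hΩm, mul_smul_comm]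
    rw [comm] at this
    exact sub_eq_iff_eq_add'.mp this
  -- `a_v (S X) = X - S (a_v X)`
  have e1 : av v * (Sop u * (Hop N ^ j * Ωop R ^ m)) =
      Hop N ^ j * Ωop R ^ m - Sop u * (av v * (Hop N ^ j * Ωop R ^ m)) := by
    rw [← mul_assoc, av_mul_Sop, hA1, one_smul, sub_mul, one_mul, mul_assoc]
  have h0 : top (av v * (Sop u * (Hop N ^ j * Ωop R ^ m))) = 0 := top_av_mul _ _
  rw [e1, e2, map_sub, mul_add, map_add, ← mul_assoc, top_mul_av, zero_add, mul_smul_comm, map_smul,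
    smul_eq_mul, sub_eq_zero] at h0
  rw [h0]
  congr 2
  -- reorder: `S (Hʲ (K Ω̂ᵐ⁻¹)) = S K Hʲ Ω̂ᵐ⁻¹`
  have hHK : Hop N ^ j * Kop R v = Kop R v * Hop N ^ j :=
    (M21_comm_of_mem_𝒵 (Subalgebra.pow_mem _ (Hop_mem_𝒵 N) j) _).symm
  rw [← mul_assoc (Hop N ^ j), hHK]
  simp only [mul_assoc]

/-- The formal Leibniz derivative `𝒟ᵢ` of `S Hʲ Ω̂ᵐ` in direction `i` (what the product rule
gives, the derivative arrays `δu, δN, δR` replacing `u, N, R` in one factor at a time; the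
`j` resp. `m` equal terms are collected using commutativity of `𝒵`). [folklore] -/
def leibnizD (i : Fin d) (j m : ℕ) : Op (Fin (d + d)) :=
  Sop (fun a => δu a i) * Hop N ^ j * Ωop R ^ m +
    (j : ℝ) • (Sop u * Hop (fun a k => δN a k i) * Hop N ^ (j - 1) * Ωop R ^ m) +
    (m : ℝ) • (Sop u * Hop N ^ j * Ωop R ^ (m - 1) * Ωop (fun a b k l => δR a b k l i))

/-- The Leibniz element in the shape produced by the product rule for `S · Hʲ · Ω̂ᵐ`
(derivative of the last factor written as `Ω̂' Ω̂ᵐ⁻¹`). [folklore] -/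
theorem leibnizD_eq' (i : Fin d) (j m : ℕ) :
    leibnizD u N R δu δN δR i j m =
      Sop u * Hop N ^ j * ((m : ℝ) • (Ωop (fun a b k l => δR a b k l i) * Ωop R ^ (m - 1))) +
        (Sop u * ((j : ℝ) • (Hop (fun a k => δN a k i) * Hop N ^ (j - 1))) +
          Sop (fun a => δu a i) * Hop N ^ j) * Ωop R ^ m := by
  rw [leibnizD, mul_comm_of_mem_𝒵 (Ωop_mem_𝒵 fun a b k l => δR a b k l i)
    (Subalgebra.pow_mem _ (Ωop_mem_𝒵 R) _)]
  simp only [smul_mul_assoc, mul_smul_comm, add_mul, mul_assoc]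
  abel

/-- Linearity of `Sop` in a scalar. [folklore] -/
theorem Sop_smul' (c : ℝ) (u : Fin d → ℝ) : Sop (fun a => c * u a) = c • Sop u := by
  simp [Sop, Finset.smul_sum, smul_smul]

/-- Linearity of `Hop` in a scalar. [folklore] -/
theorem Hop_smul' (c : ℝ) (N : Fin d → Fin d → ℝ) : Hop (fun a k => c * N a k) = c • Hop N := by
  simp [Hop, Finset.smul_sum, smul_smul]

/-- Linearity of `Ωop` in a scalar. [folklore] -/
theorem Ωop_smul' (c : ℝ) (R : Fin d → Fin d → Fin d → Fin d → ℝ) :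
    Ωop (fun a b k l => c * R a b k l) = c • Ωop R := by
  simp only [Ωop, M22, Finset.smul_sum, smul_smul, mul_comm c]
  simp only [← smul_smul, ← Finset.smul_sum]

/-- `θⁱ S(u)` lies in `𝒵`. [folklore] -/
theorem θ_mul_Sop_mem_𝒵 (i : Fin d) (u : Fin d → ℝ) : θ i * Sop u ∈ 𝒵 d := by
  rw [θ_mul_Sop_eq_sum]
  exact Subalgebra.sum_mem _ fun a _ => Subalgebra.smul_mem _ (z_mem_𝒵 a i) _

/-- **Perturbation expansion.** Along the affine line of coefficient arrays
`(u + tδu, N + tδN, R + tδR)` the Berezin integral `top(θⁱ S Hʲ Ω̂ᵐ)` is a real polynomial in `t`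
whose linear coefficient is `top(θⁱ 𝒟ᵢ)` (the Leibniz rule as the derivative of a polynomial over
the commutative algebra `𝒵`). [folklore] -/
theorem top_θ_perturb (i : Fin d) (j m : ℕ) :
    ∃ (b : ℕ → ℝ) (n₀ : ℕ), ∀ t : ℝ,
      top (θ i * (Sop (fun a => u a + t * δu a i) * Hop (fun a k => N a k + t * δN a k i) ^ j *
        Ωop (fun a b k l => R a b k l + t * δR a b k l i) ^ m)) =
      top (θ i * (Sop u * Hop N ^ j * Ωop R ^ m)) + t * top (θ i * leibnizD u N R δu δN δR i j m) +
        t ^ 2 * ∑ r ∈ Finset.range n₀, t ^ r * b r := by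
  -- the six elements of `𝒵`
  set L₀ : 𝒵 d := ⟨θ i * Sop u, θ_mul_Sop_mem_𝒵 i u⟩ with hL₀
  set L₁ : 𝒵 d := ⟨θ i * Sop fun a => δu a i, θ_mul_Sop_mem_𝒵 i _⟩ with hL₁
  set Hh : 𝒵 d := ⟨Hop N, Hop_mem_𝒵 N⟩ with hHh
  set H'h : 𝒵 d := ⟨Hop fun a k => δN a k i, Hop_mem_𝒵 _⟩ with hH'h
  set Ωh : 𝒵 d := ⟨Ωop R, Ωop_mem_𝒵 R⟩ with hΩh
  set Ω'h : 𝒵 d := ⟨Ωop fun a b k l => δR a b k l i, Ωop_mem_𝒵 _⟩ with hΩ'h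
  -- the polynomial over `𝒵`
  set PZ : Polynomial (𝒵 d) := (Polynomial.C L₀ + Polynomial.X * Polynomial.C L₁) *
    (Polynomial.C Hh + Polynomial.X * Polynomial.C H'h) ^ j *
    (Polynomial.C Ωh + Polynomial.X * Polynomial.C Ω'h) ^ m with hPZ
  -- Step 1: the perturbed element is the evaluation of `PZ`
  have step1 : ∀ t : ℝ, θ i * (Sop (fun a => u a + t * δu a i) *
      Hop (fun a k => N a k + t * δN a k i) ^ j *
      Ωop (fun a b k l => R a b k l + t * δR a b k l i) ^ m) =
      ((PZ.eval (algebraMap ℝ (𝒵 d) t) : 𝒵 d) : Op (Fin (d + d))) := by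
    intro t
    have e1 : Sop (fun a => u a + t * δu a i) = Sop u + t • Sop fun a => δu a i := by
      rw [← Sop_smul', ← Sop_add']
    have e2 : Hop (fun a k => N a k + t * δN a k i) = Hop N + t • Hop fun a k => δN a k i := by
      rw [← Hop_smul', ← Hop_add']
    have e3 : Ωop (fun a b k l => R a b k l + t * δR a b k l i) =
        Ωop R + t • Ωop fun a b k l => δR a b k l i := by
      rw [← Ωop_smul', ← Ωop_add']
    rw [e1, e2, e3, hPZ]
    simp only [Polynomial.eval_mul, Polynomial.eval_pow, Polynomial.eval_add, Polynomial.eval_C,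
      Polynomial.eval_X, ← Algebra.smul_def, Subalgebra.coe_mul, Subalgebra.coe_pow, Subalgebra.coe_add,
      Subalgebra.coe_smul, hL₀, hL₁, hHh, hH'h, hΩh, hΩ'h, mul_assoc]
    rw [← mul_assoc, mul_add, mul_smul_comm]
  -- Step 2: expand `PZ` in monomials
  set n₁ := PZ.natDegree + 3 with hn₁
  have hdeg : PZ.natDegree < n₁ := by omega
  have step2 : ∀ t : ℝ, ((PZ.eval (algebraMap ℝ (𝒵 d) t) : 𝒵 d) : Op (Fin (d + d))) =
      ∑ r ∈ Finset.range n₁, t ^ r • ((PZ.coeff r : 𝒵 d) : Op (Fin (d + d))) := by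
    intro t
    conv_lhs => rw [PZ.as_sum_range' n₁ hdeg]
    simp only [Polynomial.eval_finsetSum, Polynomial.eval_monomial, ← map_pow, ← Algebra.commutes,
      ← Algebra.smul_def, AddSubmonoidClass.coe_finsetSum, Subalgebra.coe_smul]
  -- Step 3: the constant and linear coefficients
  have hc0 : ((PZ.coeff 0 : 𝒵 d) : Op (Fin (d + d))) = θ i * (Sop u * Hop N ^ j * Ωop R ^ m) := by
    rw [Polynomial.coeff_zero_eq_eval_zero, hPZ]
    simp only [Polynomial.eval_mul, Polynomial.eval_pow, Polynomial.eval_add, Polynomial.eval_C,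
      Polynomial.eval_X, zero_mul, add_zero, Subalgebra.coe_mul, Subalgebra.coe_pow, hL₀, hHh, hΩh,
      mul_assoc]
  have hc1 : ((PZ.coeff 1 : 𝒵 d) : Op (Fin (d + d))) = θ i * leibnizD u N R δu δN δR i j m := by
    have hd : PZ.coeff 1 = (Polynomial.derivative PZ).eval 0 := by
      rw [← Polynomial.coeff_zero_eq_eval_zero, Polynomial.coeff_derivative, zero_add, Nat.cast_zero,
        zero_add, mul_one]
    have hder : (Polynomial.derivative PZ).eval 0 =
        L₁ * (Hh ^ j * Ωh ^ m) + (j : 𝒵 d) * (L₀ * (H'h * (Hh ^ (j - 1) * Ωh ^ m))) +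
          (m : 𝒵 d) * (L₀ * (Hh ^ j * (Ωh ^ (m - 1) * Ω'h))) := by
      rw [hPZ]
      simp only [Polynomial.derivative_mul, Polynomial.derivative_pow, Polynomial.derivative_add,
        Polynomial.derivative_C, Polynomial.derivative_X, Polynomial.eval_mul, Polynomial.eval_pow,
        Polynomial.eval_add, Polynomial.eval_C, Polynomial.eval_X, zero_mul, add_zero, zero_add, one_mul,
        mul_zero]
      ring
    have hZ : θ i * leibnizD u N R δu δN δR i j m =
        ((L₁ * (Hh ^ j * Ωh ^ m) + (j : 𝒵 d) * (L₀ * (H'h * (Hh ^ (j - 1) * Ωh ^ m))) +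
          (m : 𝒵 d) * (L₀ * (Hh ^ j * (Ωh ^ (m - 1) * Ω'h))) : 𝒵 d) : Op (Fin (d + d))) := by
      simp only [leibnizD, mul_add, Subalgebra.coe_add, Subalgebra.coe_mul, Subalgebra.coe_pow,
        SubringClass.coe_natCast, hL₀, hL₁, hHh, hH'h, hΩh, hΩ'h, Algebra.smul_def, map_natCast,
        mul_assoc]
      rw [← mul_assoc (j : Op (Fin (d + d))), ← mul_assoc (j : Op (Fin (d + d))),
        (Nat.cast_commute j (θ i)).eq, ← mul_assoc (m : Op (Fin (d + d))),
        ← mul_assoc (m : Op (Fin (d + d))), (Nat.cast_commute m (θ i)).eq]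
      simp only [mul_assoc]
    rw [hd, hder, hZ]
  -- assemble
  refine ⟨fun r => top ((PZ.coeff (r + 2) : 𝒵 d) : Op (Fin (d + d))), PZ.natDegree + 1, fun t => ?_⟩
  rw [step1, step2, map_sum]
  simp only [map_smul, smul_eq_mul]
  rw [hn₁, show PZ.natDegree + 3 = PZ.natDegree + 1 + 1 + 1 by ring, Finset.sum_range_succ',
    Finset.sum_range_succ', hc0, hc1]
  simp only [pow_zero, one_mul, zero_add, pow_succ, Finset.mul_sum]
  have : ∀ r : ℕ, t ^ r * t * t * top ((PZ.coeff (r + 1 + 1) : 𝒵 d) : Op (Fin (d + d))) =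
      t * t * (t ^ r * top ((PZ.coeff (r + 2) : 𝒵 d) : Op (Fin (d + d)))) := fun r => by ring
  simp only [this]
  ring

/-- **(★2)** `∑ᵢ θⁱ (𝒟ᵢ + [Gᵢ, ·])(S Hʲ Ω̂ᵐ) = Hʲ⁺¹ Ω̂ᵐ + j · S K Hʲ⁻¹ Ω̂ᵐ`: the covariant exterior
derivative of `S Hʲ Ω̂ᵐ`, computed with `∇S = H`, `∇H = -K`, `∇Ω̂ = 0` (Chern's
`dΦ_k`-computation, [cite: Chern1945, (6)–(8)]). -/
theorem sum_θ_nabla (hS1 : ∀ a i, δu a i = N a i + ∑ b, Γ b i a * u b)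
    (hS2 : ∀ a i k, δN a k i - δN a i k =
      (∑ c, R a c i k * v c) + ∑ b, (Γ b i a * N b k - Γ b k a * N b i))
    (hS3 : ∀ a b m k l, bianchiC R Γ δR a b m k l + bianchiC R Γ δR a b k l m +
      bianchiC R Γ δR a b l m k = 0) (j m : ℕ) :
    ∑ i, θ i * (leibnizD u N R δu δN δR i j m + comm (Gop Γ i) (Sop u * Hop N ^ j * Ωop R ^ m)) =
      Hop N ^ (j + 1) * Ωop R ^ m + (j : ℝ) • (Sop u * Kop R v * Hop N ^ (j - 1) * Ωop R ^ m) := by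
  -- the pieces of `[Gᵢ, S Hʲ Ω̂ᵐ]`
  have hHc : ∀ i, comm (Gop Γ i) (Hop N ^ j) =
      (j : ℝ) • (comm (Gop Γ i) (Hop N) * Hop N ^ (j - 1)) := fun i =>
    comm_pow' _ _ (by
      rw [comm_Gop_Hop]
      exact mul_comm_of_mem_𝒵 (Hop_mem_𝒵 _) (Hop_mem_𝒵 _)) j
  have hΩc : ∀ i, comm (Gop Γ i) (Ωop R ^ m) =
      (m : ℝ) • (Ωop R ^ (m - 1) * comm (Gop Γ i) (Ωop R)) := fun i => by
    have hmem : comm (Gop Γ i) (Ωop R) ∈ 𝒵 d := by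
      rw [Ωop, comm_smul, comm_Gop_M22]
      exact Subalgebra.smul_mem _ (M22_mem_𝒵 _) _
    rw [comm_pow' _ _ (mul_comm_of_mem_𝒵 (Ωop_mem_𝒵 _) hmem) m,
      mul_comm_of_mem_𝒵 hmem (Subalgebra.pow_mem _ (Ωop_mem_𝒵 R) _)]
  have hcomm : ∀ i, comm (Gop Γ i) (Sop u * Hop N ^ j * Ωop R ^ m) =
      comm (Gop Γ i) (Sop u) * Hop N ^ j * Ωop R ^ m +
        (j : ℝ) • (Sop u * comm (Gop Γ i) (Hop N) * Hop N ^ (j - 1) * Ωop R ^ m) +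
        (m : ℝ) • (Sop u * Hop N ^ j * Ωop R ^ (m - 1) * comm (Gop Γ i) (Ωop R)) := by
    intro i
    rw [comm_mul, comm_mul, hHc, hΩc]
    simp only [mul_smul_comm, smul_mul_assoc, mul_assoc, add_mul]
  -- regroup summand into the three covariant differentials
  have hsummand : ∀ i, θ i * (leibnizD u N R δu δN δR i j m +
      comm (Gop Γ i) (Sop u * Hop N ^ j * Ωop R ^ m)) =
      θ i * (Sop (fun a => δu a i) + comm (Gop Γ i) (Sop u)) * (Hop N ^ j * Ωop R ^ m) +
      (-(j : ℝ)) • (Sop u * (θ i * (Hop (fun a k => δN a k i) + comm (Gop Γ i) (Hop N))) *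
        (Hop N ^ (j - 1) * Ωop R ^ m)) +
      (-(m : ℝ)) • (Sop u * (Hop N ^ j * Ωop R ^ (m - 1)) *
        (θ i * (Ωop (fun a b k l => δR a b k l i) + comm (Gop Γ i) (Ωop R)))) := by
    intro i
    have hSθ : ∀ Y, Sop u * (θ i * Y) = -(θ i * (Sop u * Y)) := fun Y => by
      have h' : Sop u * θ i = -(θ i * Sop u) := by rw [θ_mul_Sop, neg_neg]
      rw [← mul_assoc, h', neg_mul, mul_assoc]
    have hθH : θ i * Hop N ^ j = Hop N ^ j * θ i :=
      θ_comm_of_mem_𝒵 (Subalgebra.pow_mem _ (Hop_mem_𝒵 N) _) i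
    have hθΩ : θ i * Ωop R ^ (m - 1) = Ωop R ^ (m - 1) * θ i :=
      θ_comm_of_mem_𝒵 (Subalgebra.pow_mem _ (Ωop_mem_𝒵 R) _) i
    have hXθ : ∀ Y, Hop N ^ j * (Ωop R ^ (m - 1) * (θ i * Y)) =
        θ i * (Hop N ^ j * (Ωop R ^ (m - 1) * Y)) := fun Y => by
      rw [← mul_assoc (Ωop R ^ (m - 1)), ← hθΩ, mul_assoc (θ i), ← mul_assoc (Hop N ^ j), ← hθH,
        mul_assoc]
    rw [hcomm, leibnizD]
    simp only [mul_add, add_mul, smul_add, mul_smul_comm, mul_assoc, neg_smul, smul_neg, neg_neg,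
      neg_mul, hSθ, hXθ]
    abel
  have hT1 : ∑ i, θ i * (Sop (fun a => δu a i) + comm (Gop Γ i) (Sop u)) * (Hop N ^ j * Ωop R ^ m) =
      Hop N * (Hop N ^ j * Ωop R ^ m) := by
    rw [← Finset.sum_mul, nablaS u N Γ δu hS1]
  have hT2 : ∑ i, (-(j : ℝ)) • (Sop u * (θ i * (Hop (fun a k => δN a k i) +
      comm (Gop Γ i) (Hop N))) * (Hop N ^ (j - 1) * Ωop R ^ m)) =
      (j : ℝ) • (Sop u * Kop R v * (Hop N ^ (j - 1) * Ωop R ^ m)) := by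
    rw [← Finset.smul_sum, ← Finset.sum_mul, ← Finset.mul_sum, nablaH v N R Γ δN hS2]
    simp only [mul_neg, neg_mul, smul_neg, neg_smul, neg_neg]
  have hT3 : ∑ i, (-(m : ℝ)) • (Sop u * (Hop N ^ j * Ωop R ^ (m - 1)) *
      (θ i * (Ωop (fun a b k l => δR a b k l i) + comm (Gop Γ i) (Ωop R)))) = 0 := by
    rw [← Finset.smul_sum, ← Finset.mul_sum, nablaΩ R Γ δR hS3, mul_zero, smul_zero]
  rw [Finset.sum_congr rfl fun i _ => hsummand i, Finset.sum_add_distrib, Finset.sum_add_distrib,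
    hT1, hT2, hT3]
  simp only [add_zero, pow_succ', mul_assoc]


/-- **Divergence identity.** With `∂ᵢρ = -ρ Γᵃᵢₐ` (Jacobi's formula for `ρ = (√det g)⁻¹`), the
formal coordinate divergence `∑ᵢ ∂ᵢ(ρ · top(θⁱ S Hʲ Ω̂ᵐ))` equals `ρ` times the Berezin integral of
the covariant exterior derivative: the connection terms are absorbed by the trace identity.
[cite: Chern1945, (11)] -/
theorem div_core (ρ : ℝ) (δρ : Fin d → ℝ) (hS4 : ∀ i, δρ i = -ρ * ∑ a, Γ a i a)
    (hS1 : ∀ a i, δu a i = N a i + ∑ b, Γ b i a * u b)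
    (hS2 : ∀ a i k, δN a k i - δN a i k =
      (∑ c, R a c i k * v c) + ∑ b, (Γ b i a * N b k - Γ b k a * N b i))
    (hS3 : ∀ a b m k l, bianchiC R Γ δR a b m k l + bianchiC R Γ δR a b k l m +
      bianchiC R Γ δR a b l m k = 0) (j m : ℕ) :
    ∑ i, (δρ i * top (θ i * (Sop u * Hop N ^ j * Ωop R ^ m)) +
        ρ * top (θ i * leibnizD u N R δu δN δR i j m)) =
      ρ * (top (Hop N ^ (j + 1) * Ωop R ^ m) +
        (j : ℝ) * top (Sop u * Kop R v * Hop N ^ (j - 1) * Ωop R ^ m)) := by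
  have h : ∀ i, δρ i * top (θ i * (Sop u * Hop N ^ j * Ωop R ^ m)) +
      ρ * top (θ i * leibnizD u N R δu δN δR i j m) =
      ρ * top (θ i * (leibnizD u N R δu δN δR i j m +
        comm (Gop Γ i) (Sop u * Hop N ^ j * Ωop R ^ m))) := by
    intro i
    rw [mul_add, map_add, top_θ_comm_Gop, hS4]
    ring
  rw [Finset.sum_congr rfl fun i _ => h i, ← Finset.mul_sum, ← map_sum,
    sum_θ_nabla u v N R Γ δu δN δR hS1 hS2 hS3, map_add, map_smul, smul_eq_mul]

end Structure

/-! ### Telescoping the recursion -/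

/-- Abstract telescoping: if `a₀ = 0` and `a_{k+1} = -b_k` below the top index, then
`∑_{k<p} (a_k G_{k-1} + b_k G_k) = b_{p-1} G_{p-1}`. [folklore] -/
theorem sum_range_telescope (a b G : ℕ → ℝ) {p : ℕ} (hp : 0 < p) (h0 : a 0 = 0)
    (h : ∀ k, k + 1 < p → a (k + 1) + b k = 0) :
    ∑ k ∈ Finset.range p, (a k * G (k - 1) + b k * G k) = b (p - 1) * G (p - 1) := by
  obtain ⟨q, rfl⟩ : ∃ q, p = q + 1 := ⟨p - 1, by omega⟩
  rw [Finset.sum_add_distrib, Finset.sum_range_succ' _ q, Finset.sum_range_succ _ q, h0, zero_mul,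
    add_zero, Nat.add_sub_cancel]
  have : ∑ k ∈ Finset.range q, a (k + 1) * G (k + 1 - 1) + ∑ k ∈ Finset.range q, b k * G k = 0 := by
    rw [← Finset.sum_add_distrib]
    refine Finset.sum_eq_zero fun k hk => ?_
    rw [Nat.add_sub_cancel, ← add_mul, h k (by simpa using hk), zero_mul]
  linarith

/-- The transgression coefficients in signed form, `γₖ = (-1)ᵏ / (k! (d-1-2k)!!)`
(`= (-4)ᵏ cₖ` for the file's `cₖ = chernTransgressionCoeff d k`). [cite: Chern1945, (9)] -/
def γcoeff (d k : ℕ) : ℝ := (-1) ^ k / ((k ! : ℕ) * ((d - 1 - 2 * k)‼ : ℕ))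

/-- The recursion of the coefficients: `(k+1)γ_{k+1} = -(d-1-2k)γ_k` for `k + 1 < d/2`.
[cite: Chern1945, (9)] -/
theorem γcoeff_succ {d p k : ℕ} (hd : d = 2 * p) (hk : k + 1 < p) :
    γcoeff d (k + 1) * (k + 1 : ℕ) + γcoeff d k * (d - 1 - 2 * k : ℕ) = 0 := by
  obtain ⟨n, hn⟩ : ∃ n, d - 1 - 2 * k = n + 2 := ⟨d - 3 - 2 * k, by omega⟩
  have hn' : d - 1 - 2 * (k + 1) = n := by omega
  rw [γcoeff, γcoeff, hn', hn, Nat.doubleFactorial_add_two, Nat.factorial_succ]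
  have h1 : ((k ! : ℕ) : ℝ) ≠ 0 := by positivity
  have h2 : ((n‼ : ℕ) : ℝ) ≠ 0 := by exact_mod_cast (Nat.doubleFactorial_pos n).ne'
  push_cast
  field_simp
  ring

/-- The top coefficient: `γ_{p-1} · (d-1-2(p-1)) = (-1)^{p-1}/(p-1)!`. [cite: Chern1945, (9)] -/
theorem γcoeff_top {d p : ℕ} (hd : d = 2 * p) (hp : 0 < p) :
    γcoeff d (p - 1) * (d - 1 - 2 * (p - 1) : ℕ) = (-1) ^ (p - 1) / ((p - 1)! : ℕ) := by
  have h : d - 1 - 2 * (p - 1) = 1 := by omega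
  have h1 : (1‼ : ℕ) = 1 := rfl
  rw [γcoeff, h, h1]
  simp

/-- **Chern's telescoping.** For any `G`, `∑_{k<p} γₖ (k G_{k-1} + (d-1-2k) G_k) = (-1)^{p-1} G_{p-1}/(p-1)!`.
[cite: Chern1945, (9)–(11)] -/
theorem sum_γcoeff_telescope {d p : ℕ} (hd : d = 2 * p) (hp : 0 < p) (G : ℕ → ℝ) :
    ∑ k ∈ Finset.range p, γcoeff d k * ((k : ℕ) * G (k - 1) + ((d - 1 - 2 * k : ℕ) : ℝ) * G k) =
      (-1) ^ (p - 1) / ((p - 1)! : ℕ) * G (p - 1) := by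
  have key := sum_range_telescope (fun k => γcoeff d k * k)
    (fun k => γcoeff d k * (d - 1 - 2 * k : ℕ)) G hp (by simp)
    (fun k hk => by exact_mod_cast γcoeff_succ hd hk)
  rw [← γcoeff_top hd hp, ← key]
  refine Finset.sum_congr rfl fun k _ => ?_
  ring

/-! ### Bridges to the double alternating sums of the coordinate file -/

section Bridge

/-- The quadratic element `Q(R) = ∑ R_{abkl} z a k · z b l` of `𝒵` (so that `Ω̂ = -¼ Q`).
[cite: Chern1945, (2)] -/
def Qh (R : Fin d → Fin d → Fin d → Fin d → ℝ) : 𝒵 d :=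
  ∑ b, ∑ l, Lh (fun a c => R a b c l) * zh b l

/-- `Q(R)` as an explicit operator sum. [folklore] -/
theorem coe_Qh_eq_sum (R : Fin d → Fin d → Fin d → Fin d → ℝ) :
    ((Qh R : 𝒵 d) : Op (Fin (d + d))) = ∑ a, ∑ b, ∑ c, ∑ l, R a b c l • (z a c * z b l) := by
  simp only [Qh, Lh, AddSubmonoidClass.coe_finsetSum, Subalgebra.coe_mul, Subalgebra.coe_smul,
    coe_zh, Finset.sum_mul, smul_mul_assoc]
  calc (∑ b, ∑ l, ∑ a, ∑ c, R a b c l • (z a c * z b l))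
      = ∑ b, ∑ a, ∑ c, ∑ l, R a b c l • (z a c * z b l) :=
        Finset.sum_congr rfl fun b _ =>
          Finset.sum_comm.trans (Finset.sum_congr rfl fun a _ => Finset.sum_comm)
    _ = ∑ a, ∑ b, ∑ c, ∑ l, R a b c l • (z a c * z b l) := Finset.sum_comm

/-- `M22(R)` as an explicit operator sum in the `z`'s. [folklore] -/
theorem M22_eq_neg_sum (R : Fin d → Fin d → Fin d → Fin d → ℝ) :
    M22 R = -∑ a, ∑ b, ∑ c, ∑ l, R a b c l • (z a c * z b l) := by
  simp only [M22, θθχχ_eq_neg_zz, smul_neg, Finset.sum_neg_distrib]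

/-- `Q(R) = -M22(R)` as operators. [folklore] -/
theorem coe_Qh (R : Fin d → Fin d → Fin d → Fin d → ℝ) :
    ((Qh R : 𝒵 d) : Op (Fin (d + d))) = -M22 R := by
  rw [M22_eq_neg_sum, neg_neg, coe_Qh_eq_sum]

/-- `Ω̂ = -¼ Q`. [folklore] -/
theorem Ωop_eq_smul_Qh (R : Fin d → Fin d → Fin d → Fin d → ℝ) :
    Ωop R = (-(1 / 4 : ℝ)) • ((Qh R : 𝒵 d) : Op (Fin (d + d))) := by
  rw [coe_Qh, Ωop, smul_neg, neg_smul, neg_neg]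

/-- The unit slot matrix is sent to a generator. [folklore] -/
theorem Lh_single (b l : Fin d) :
    Lh (fun a c => if a = b ∧ c = l then (1 : ℝ) else 0) = (zh b l : 𝒵 d) := by
  unfold Lh
  rw [Finset.sum_eq_single_of_mem b (Finset.mem_univ b) (fun a _ ha => by simp [ha]),
    Finset.sum_eq_single_of_mem l (Finset.mem_univ l) (fun c _ hc => by simp [hc])]
  simp

/-- Sums over a product type of a function against a Kronecker delta. [folklore] -/
theorem sum_mul_ite_eq_pair {α : Type*} [Fintype α] [DecidableEq α] (f : α × α → ℝ) (a c : α) :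
    ∑ q : α × α, f q * (if a = q.1 ∧ c = q.2 then 1 else 0) = f (a, c) := by
  rw [Finset.sum_eq_single (a, c)]
  · simp
  · rintro ⟨b, l⟩ _ h
    have : ¬(a = b ∧ c = l) := fun hh => h (by rw [hh.1, hh.2])
    simp [this]
  · simp

variable (d) in
/-- The pairing equivalence `Fin (d/2) ⊕ Fin (d/2) ≃ Fin d`, `inl m ↦ 2m`, `inr m ↦ 2m+1` (`d` even).
[folklore] -/
def pairEquiv (hd : Even d) : Fin (d / 2) ⊕ Fin (d / 2) ≃ Fin d where
  toFun := Sum.elim pairFst pairSnd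
  invFun s := if s.val % 2 = 0 then Sum.inl ⟨s.val / 2, by obtain ⟨r, hr⟩ := hd; omega⟩
    else Sum.inr ⟨s.val / 2, by obtain ⟨r, hr⟩ := hd; omega⟩
  left_inv q := by
    rcases q with m | m
    · have h : (pairFst m).val % 2 = 0 := by rw [pairFst_val]; omega
      simp only [Sum.elim_inl, h, if_true, Sum.inl.injEq]
      exact Fin.ext (by simp [pairFst_val])
    · have h : ¬((pairSnd m).val % 2 = 0) := by rw [pairSnd_val]; omega
      simp only [Sum.elim_inr, h, if_false, Sum.inr.injEq]
      exact Fin.ext (by simp [pairSnd_val]; omega)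
  right_inv s := by
    by_cases h : s.val % 2 = 0
    · simp only [h, if_true, Sum.elim_inl]
      exact Fin.ext (by simp [pairFst_val]; omega)
    · simp only [h, if_false, Sum.elim_inr]
      exact Fin.ext (by simp [pairSnd_val]; omega)

/-- `pairEquiv` on the left summand. [folklore] -/
@[simp]
theorem pairEquiv_inl (hd : Even d) (m : Fin (d / 2)) : pairEquiv d hd (Sum.inl m) = pairFst m := rfl

/-- `pairEquiv` on the right summand. [folklore] -/
@[simp]
theorem pairEquiv_inr (hd : Even d) (m : Fin (d / 2)) : pairEquiv d hd (Sum.inr m) = pairSnd m := rfl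

/-- The generic Euler double sum (the shape of `eulerDensitySum`). [cite: Chern1945, (10)] -/
def eSum (R : Fin d → Fin d → Fin d → Fin d → ℝ) : ℝ :=
  ∑ σ : Equiv.Perm (Fin d), ∑ τ : Equiv.Perm (Fin d),
    ((Equiv.Perm.sign σ : ℤ) : ℝ) * ((Equiv.Perm.sign τ : ℤ) : ℝ) *
      ∏ m : Fin (d / 2), R (σ (pairFst m)) (σ (pairSnd m)) (τ (pairFst m)) (τ (pairSnd m))

/-- `eulerDensitySum` is an instance of `eSum`. [cite: Chern1945, (10)] -/
theorem eulerDensitySum_eq_eSum (g : (Fin d → ℝ) → Matrix (Fin d) (Fin d) ℝ) (x : Fin d → ℝ) :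
    eulerDensitySum g x = eSum (coordRiemann g x) := rfl

/-- **E-bridge.** `β · eSum R = top (Q(R)^{d/2})` for even `d`. [cite: Chern1945, (10)] -/
theorem β_mul_eSum (hd : Even d) (R : Fin d → Fin d → Fin d → Fin d → ℝ) :
    β d * eSum R = top ((Qh R ^ (d / 2) : 𝒵 d) : Op (Fin (d + d))) := by
  -- slot data
  set Me : (Fin (d / 2) → Fin d × Fin d) → Fin d → Fin d → Fin d → ℝ := fun lam s =>
    Sum.elim (fun m => fun a c => R a (lam m).1 c (lam m).2)
      (fun m => fun a c => if a = (lam m).1 ∧ c = (lam m).2 then (1 : ℝ) else 0)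
      ((pairEquiv d hd).symm s) with hMe
  have hMe1 : ∀ lam m, Me lam (pairFst m) = fun a c => R a (lam m).1 c (lam m).2 := fun lam m => by
    have : (pairEquiv d hd).symm (pairFst m) = Sum.inl m := by
      rw [← pairEquiv_inl hd m, Equiv.symm_apply_apply]
    simp only [hMe, this, Sum.elim_inl]
  have hMe2 : ∀ lam m, Me lam (pairSnd m) =
      fun a c => if a = (lam m).1 ∧ c = (lam m).2 then (1 : ℝ) else 0 := fun lam m => by
    have : (pairEquiv d hd).symm (pairSnd m) = Sum.inr m := by
      rw [← pairEquiv_inr hd m, Equiv.symm_apply_apply]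
    simp only [hMe, this, Sum.elim_inr]
  -- (1) the summand as a sum over `lam`
  have h1 : ∀ σ τ : Equiv.Perm (Fin d),
      (∏ m : Fin (d / 2), R (σ (pairFst m)) (σ (pairSnd m)) (τ (pairFst m)) (τ (pairSnd m))) =
        ∑ lam : Fin (d / 2) → Fin d × Fin d, ∏ s, Me lam s (σ s) (τ s) := by
    intro σ τ
    have hsplit : ∀ lam : Fin (d / 2) → Fin d × Fin d, ∏ s, Me lam s (σ s) (τ s) =
        ∏ m, (R (σ (pairFst m)) (lam m).1 (τ (pairFst m)) (lam m).2 *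
          if σ (pairSnd m) = (lam m).1 ∧ τ (pairSnd m) = (lam m).2 then 1 else 0) := by
      intro lam
      rw [← Fintype.prod_equiv (pairEquiv d hd) (fun q => Me lam (pairEquiv d hd q)
        (σ (pairEquiv d hd q)) (τ (pairEquiv d hd q))) _ (fun _ => rfl),
        Fintype.prod_sum_type, ← Finset.prod_mul_distrib]
      simp only [pairEquiv_inl, pairEquiv_inr, hMe1, hMe2]
    simp_rw [hsplit]
    rw [← Fintype.prod_sum fun m (q : Fin d × Fin d) =>
      R (σ (pairFst m)) q.1 (τ (pairFst m)) q.2 *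
        if σ (pairSnd m) = q.1 ∧ τ (pairSnd m) = q.2 then 1 else 0]
    exact Finset.prod_congr rfl fun m _ => (sum_mul_ite_eq_pair
      (fun q => R (σ (pairFst m)) q.1 (τ (pairFst m)) q.2) (σ (pairSnd m)) (τ (pairSnd m))).symm
  -- (2) the product of linear elements for fixed `lam`
  have h2 : ∀ lam : Fin (d / 2) → Fin d × Fin d, (∏ s, Lh (Me lam s) : 𝒵 d) =
      ∏ m, (Lh (fun a c => R a (lam m).1 c (lam m).2) * zh (lam m).1 (lam m).2) := by
    intro lam
    rw [← Fintype.prod_equiv (pairEquiv d hd) (fun q => Lh (Me lam (pairEquiv d hd q))) _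
      (fun _ => rfl), Fintype.prod_sum_type, ← Finset.prod_mul_distrib]
    simp only [pairEquiv_inl, pairEquiv_inr, hMe1, hMe2, Lh_single]
  -- assemble
  calc β d * eSum R
      = ∑ lam : Fin (d / 2) → Fin d × Fin d, β d * ∑ σ : Equiv.Perm (Fin d), ∑ τ : Equiv.Perm (Fin d),
          ((Equiv.Perm.sign σ : ℤ) : ℝ) * ((Equiv.Perm.sign τ : ℤ) : ℝ) * ∏ s, Me lam s (σ s) (τ s) := by
        simp only [eSum, h1, Finset.mul_sum]
        exact (Finset.sum_congr rfl fun σ _ => Finset.sum_comm).trans Finset.sum_comm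
    _ = ∑ lam : Fin (d / 2) → Fin d × Fin d, top ((∏ s, Lh (Me lam s) : 𝒵 d) : Op (Fin (d + d))) := by
        simp only [top_prod_Lh]
    _ = top ((∑ lam : Fin (d / 2) → Fin d × Fin d, ∏ m,
          (Lh (fun a c => R a (lam m).1 c (lam m).2) * zh (lam m).1 (lam m).2) : 𝒵 d) :
            Op (Fin (d + d))) := by
        simp only [h2, AddSubmonoidClass.coe_finsetSum, map_sum]
    _ = top ((Qh R ^ (d / 2) : 𝒵 d) : Op (Fin (d + d))) := by
        rw [← Fintype.prod_sum fun (_ : Fin (d / 2)) (q : Fin d × Fin d) =>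
          Lh (fun a c => R a q.1 c q.2) * zh q.1 q.2]
        simp only [Finset.prod_const, Finset.card_univ, Fintype.card_fin, Qh, Fintype.sum_prod_type]

/-! #### The transgression sums -/

/-- The generic transgression double sum (the shape of `chernTransgressionSum`).
[cite: Chern1945, (4)] -/
def tgSum (uL : Fin d → ℝ) (R : Fin d → Fin d → Fin d → Fin d → ℝ) (N : Fin d → Fin d → ℝ)
    (k : Fin (d / 2)) (i : Fin d) : ℝ :=
  ∑ σ : Equiv.Perm (Fin d), ∑ τ : Equiv.Perm (Fin d),
    if τ (tgZero k) = i then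
      ((Equiv.Perm.sign σ : ℤ) : ℝ) * ((Equiv.Perm.sign τ : ℤ) : ℝ) *
        uL (σ (tgZero k)) *
        (∏ m : Fin k, R (σ (tgPairFst k m)) (σ (tgPairSnd k m))
          (τ (tgPairFst k m)) (τ (tgPairSnd k m))) *
        ∏ s ∈ univ.filter (fun s : Fin d => 2 * (k : ℕ) + 1 ≤ (s : ℕ)), N (σ s) (τ s)
    else 0

/-- `chernTransgressionSum` is an instance of `tgSum`. [cite: Chern1945, (4)] -/
theorem chernTransgressionSum_eq_tgSum (g : (Fin d → ℝ) → Matrix (Fin d) (Fin d) ℝ)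
    (V : (Fin d → ℝ) → (Fin d → ℝ)) (x : Fin d → ℝ) (k : Fin (d / 2)) (i : Fin d) :
    chernTransgressionSum g V x k i =
      tgSum (g x *ᵥ unitField g V x) (coordRiemann g x) (covDerivUnitField g V x) k i := rfl

/-- The tail slots `2k+1+t`. [folklore] -/
def tgTail (k : Fin (d / 2)) (t : Fin (d - (2 * (k : ℕ) + 1))) : Fin d :=
  ⟨2 * (k : ℕ) + 1 + t, by have := t.2; omega⟩

/-- Value of a tail slot. [folklore] -/
@[simp]
theorem tgTail_val (k : Fin (d / 2)) (t : Fin (d - (2 * (k : ℕ) + 1))) :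
    (tgTail k t : ℕ) = 2 * (k : ℕ) + 1 + t := rfl

/-- The slot equivalence `{0} ⊔ (pairs) ⊔ (tail) ≃ Fin d` of the `k`-th transgression term.
[folklore] -/
def tgEquiv (k : Fin (d / 2)) :
    Unit ⊕ ((Fin k ⊕ Fin k) ⊕ Fin (d - (2 * (k : ℕ) + 1))) ≃ Fin d where
  toFun := Sum.elim (fun _ => tgZero k) (Sum.elim (Sum.elim (tgPairFst k) (tgPairSnd k)) (tgTail k))
  invFun s :=
    if h1 : s.val = 0 then Sum.inl ()
    else if h2 : s.val ≤ 2 * (k : ℕ) then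
      (if h3 : s.val % 2 = 1 then Sum.inr (Sum.inl (Sum.inl ⟨(s.val - 1) / 2, by omega⟩))
        else Sum.inr (Sum.inl (Sum.inr ⟨(s.val - 2) / 2, by omega⟩)))
    else Sum.inr (Sum.inr ⟨s.val - (2 * (k : ℕ) + 1), by omega⟩)
  left_inv q := by
    rcases q with u | ((m | m) | t)
    · have h1 : (tgZero k : Fin d).val = 0 := rfl
      dsimp only [Sum.elim_inl]
      rw [dif_pos h1]
    · have h1 : ¬((tgPairFst k m).val = 0) := by rw [tgPairFst_val]; omega
      have h2 : (tgPairFst k m).val ≤ 2 * (k : ℕ) := by rw [tgPairFst_val]; omega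
      have h3 : (tgPairFst k m).val % 2 = 1 := by rw [tgPairFst_val]; omega
      dsimp only [Sum.elim_inr, Sum.elim_inl]
      rw [dif_neg h1, dif_pos h2, dif_pos h3]
      simp only [Sum.inr.injEq, Sum.inl.injEq]
      exact Fin.ext (by simp [tgPairFst_val])
    · have h1 : ¬((tgPairSnd k m).val = 0) := by rw [tgPairSnd_val]; omega
      have h2 : (tgPairSnd k m).val ≤ 2 * (k : ℕ) := by rw [tgPairSnd_val]; omega
      have h3 : ¬((tgPairSnd k m).val % 2 = 1) := by rw [tgPairSnd_val]; omega
      dsimp only [Sum.elim_inr, Sum.elim_inl]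
      rw [dif_neg h1, dif_pos h2, dif_neg h3]
      simp only [Sum.inr.injEq, Sum.inl.injEq]
      exact Fin.ext (by simp [tgPairSnd_val])
    · have h1 : ¬((tgTail k t).val = 0) := by rw [tgTail_val]; omega
      have h2 : ¬((tgTail k t).val ≤ 2 * (k : ℕ)) := by rw [tgTail_val]; omega
      dsimp only [Sum.elim_inr]
      rw [dif_neg h1, dif_neg h2]
      simp only [Sum.inr.injEq]
      exact Fin.ext (by simp [tgTail_val])
  right_inv s := by
    by_cases h1 : s.val = 0
    · dsimp only
      rw [dif_pos h1, Sum.elim_inl]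
      exact Fin.ext (by rw [tgZero_val, h1])
    · by_cases h2 : s.val ≤ 2 * (k : ℕ)
      · by_cases h3 : s.val % 2 = 1
        · dsimp only
          rw [dif_neg h1, dif_pos h2, dif_pos h3, Sum.elim_inr, Sum.elim_inl, Sum.elim_inl]
          exact Fin.ext (by rw [tgPairFst_val]; dsimp only; omega)
        · dsimp only
          rw [dif_neg h1, dif_pos h2, dif_neg h3, Sum.elim_inr, Sum.elim_inl, Sum.elim_inr]
          exact Fin.ext (by rw [tgPairSnd_val]; dsimp only; omega)
      · dsimp only
        rw [dif_neg h1, dif_neg h2, Sum.elim_inr, Sum.elim_inr]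
        exact Fin.ext (by rw [tgTail_val]; dsimp only; omega)

/-- Slot `0`. [folklore] -/
@[simp] theorem tgEquiv_zero (k : Fin (d / 2)) (u : Unit) : tgEquiv k (Sum.inl u) = tgZero k := rfl

/-- Odd pair slots. [folklore] -/
@[simp] theorem tgEquiv_fst (k : Fin (d / 2)) (m : Fin k) :
    tgEquiv k (Sum.inr (Sum.inl (Sum.inl m))) = tgPairFst k m := rfl

/-- Even pair slots. [folklore] -/
@[simp] theorem tgEquiv_snd (k : Fin (d / 2)) (m : Fin k) :
    tgEquiv k (Sum.inr (Sum.inl (Sum.inr m))) = tgPairSnd k m := rfl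

/-- Tail slots. [folklore] -/
@[simp] theorem tgEquiv_tail (k : Fin (d / 2)) (t : Fin (d - (2 * (k : ℕ) + 1))) :
    tgEquiv k (Sum.inr (Sum.inr t)) = tgTail k t := rfl

/-- The tail product over the filtered slots as a product over `Fin (d - (2k+1))`. [folklore] -/
theorem prod_filter_tail {M : Type*} [CommMonoid M] (k : Fin (d / 2)) (f : Fin d → M) :
    ∏ s ∈ univ.filter (fun s : Fin d => 2 * (k : ℕ) + 1 ≤ (s : ℕ)), f s = ∏ t, f (tgTail k t) := by
  have hinj : Function.Injective (tgTail k) := fun t t' h => by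
    have := congrArg Fin.val h
    simp only [tgTail_val] at this
    exact Fin.ext (by omega)
  calc ∏ s ∈ univ.filter (fun s : Fin d => 2 * (k : ℕ) + 1 ≤ (s : ℕ)), f s
      = ∏ s ∈ Finset.univ.map ⟨tgTail k, hinj⟩, f s := by
        refine Finset.prod_congr ?_ fun _ _ => rfl
        ext s
        simp only [Finset.mem_filter, Finset.mem_univ, true_and, Finset.mem_map,
          Function.Embedding.coeFn_mk]
        constructor
        · intro hs
          exact ⟨⟨s.val - (2 * (k : ℕ) + 1), by omega⟩, Fin.ext (by simp; omega)⟩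
        · rintro ⟨t, rfl⟩
          simp
    _ = ∏ t, f (tgTail k t) := Finset.prod_map _ _ _

/-- The slot-`0` linear element is `θⁱ S`. [folklore] -/
theorem coe_Lh_slot0 (uL : Fin d → ℝ) (i : Fin d) :
    ((Lh (fun a c => uL a * if c = i then (1 : ℝ) else 0) : 𝒵 d) : Op (Fin (d + d))) =
      θ i * Sop uL := by
  rw [θ_mul_Sop_eq_sum]
  simp only [Lh, mul_ite, mul_one, mul_zero, ite_smul, zero_smul, Finset.sum_ite_eq',
    Finset.mem_univ, if_true, AddSubmonoidClass.coe_finsetSum, Subalgebra.coe_smul, coe_zh]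

/-- **T-bridge.** `β · tgSum = top (θⁱ S · Q^k · H^{d-1-2k})` (in `𝒵`-form). [cite: Chern1945, (4)] -/
theorem β_mul_tgSum (uL : Fin d → ℝ) (R : Fin d → Fin d → Fin d → Fin d → ℝ)
    (N : Fin d → Fin d → ℝ) (k : Fin (d / 2)) (i : Fin d) :
    β d * tgSum uL R N k i =
      top ((Lh (fun a c => uL a * if c = i then (1 : ℝ) else 0) * Qh R ^ (k : ℕ) *
        Lh N ^ (d - (2 * (k : ℕ) + 1)) : 𝒵 d) : Op (Fin (d + d))) := by
  -- slot data
  set Mt : (Fin k → Fin d × Fin d) → Fin d → Fin d → Fin d → ℝ := fun lam s =>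
    Sum.elim (fun _ => fun a c => uL a * if c = i then (1 : ℝ) else 0)
      (Sum.elim (Sum.elim (fun m => fun a c => R a (lam m).1 c (lam m).2)
        (fun m => fun a c => if a = (lam m).1 ∧ c = (lam m).2 then (1 : ℝ) else 0))
        (fun _ => N)) ((tgEquiv k).symm s) with hMt
  have hMt0 : ∀ lam, Mt lam (tgZero k) = fun a c => uL a * if c = i then (1 : ℝ) else 0 := fun lam => by
    have : (tgEquiv k).symm (tgZero k) = Sum.inl () := by
      rw [← tgEquiv_zero k, Equiv.symm_apply_apply]
    simp only [hMt, this, Sum.elim_inl]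
  have hMt1 : ∀ lam m, Mt lam (tgPairFst k m) = fun a c => R a (lam m).1 c (lam m).2 := fun lam m => by
    have : (tgEquiv k).symm (tgPairFst k m) = Sum.inr (Sum.inl (Sum.inl m)) := by
      rw [← tgEquiv_fst k m, Equiv.symm_apply_apply]
    simp only [hMt, this, Sum.elim_inr, Sum.elim_inl]
  have hMt2 : ∀ lam m, Mt lam (tgPairSnd k m) =
      fun a c => if a = (lam m).1 ∧ c = (lam m).2 then (1 : ℝ) else 0 := fun lam m => by
    have : (tgEquiv k).symm (tgPairSnd k m) = Sum.inr (Sum.inl (Sum.inr m)) := by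
      rw [← tgEquiv_snd k m, Equiv.symm_apply_apply]
    simp only [hMt, this, Sum.elim_inr, Sum.elim_inl]
  have hMt3 : ∀ lam t, Mt lam (tgTail k t) = N := fun lam t => by
    have : (tgEquiv k).symm (tgTail k t) = Sum.inr (Sum.inr t) := by
      rw [← tgEquiv_tail k t, Equiv.symm_apply_apply]
    simp only [hMt, this, Sum.elim_inr]
  -- (1) the summand as a sum over `lam`
  have h1 : ∀ σ τ : Equiv.Perm (Fin d),
      (if τ (tgZero k) = i then
        ((Equiv.Perm.sign σ : ℤ) : ℝ) * ((Equiv.Perm.sign τ : ℤ) : ℝ) *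
          uL (σ (tgZero k)) *
          (∏ m : Fin k, R (σ (tgPairFst k m)) (σ (tgPairSnd k m))
            (τ (tgPairFst k m)) (τ (tgPairSnd k m))) *
          ∏ s ∈ univ.filter (fun s : Fin d => 2 * (k : ℕ) + 1 ≤ (s : ℕ)), N (σ s) (τ s)
        else 0) =
      ((Equiv.Perm.sign σ : ℤ) : ℝ) * ((Equiv.Perm.sign τ : ℤ) : ℝ) *
        ∑ lam : Fin k → Fin d × Fin d, ∏ s, Mt lam s (σ s) (τ s) := by
    intro σ τ
    have hsplit : ∀ lam : Fin k → Fin d × Fin d, ∏ s, Mt lam s (σ s) (τ s) =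
        (uL (σ (tgZero k)) * if τ (tgZero k) = i then 1 else 0) *
        ((∏ m, (R (σ (tgPairFst k m)) (lam m).1 (τ (tgPairFst k m)) (lam m).2 *
          if σ (tgPairSnd k m) = (lam m).1 ∧ τ (tgPairSnd k m) = (lam m).2 then 1 else 0)) *
          ∏ t, N (σ (tgTail k t)) (τ (tgTail k t))) := by
      intro lam
      rw [← Fintype.prod_equiv (tgEquiv k) (fun q => Mt lam (tgEquiv k q)
        (σ (tgEquiv k q)) (τ (tgEquiv k q))) _ (fun _ => rfl),
        Fintype.prod_sum_type, Fintype.prod_sum_type, Fintype.prod_sum_type,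
        ← Finset.prod_mul_distrib]
      simp only [tgEquiv_zero, tgEquiv_fst, tgEquiv_snd, tgEquiv_tail, hMt0, hMt1, hMt2, hMt3,
        Finset.univ_unique, Finset.prod_singleton]
    have hlam : ∑ lam : Fin k → Fin d × Fin d, ∏ m, (R (σ (tgPairFst k m)) (lam m).1
        (τ (tgPairFst k m)) (lam m).2 *
          if σ (tgPairSnd k m) = (lam m).1 ∧ τ (tgPairSnd k m) = (lam m).2 then 1 else 0) =
        ∏ m : Fin k, R (σ (tgPairFst k m)) (σ (tgPairSnd k m))
          (τ (tgPairFst k m)) (τ (tgPairSnd k m)) := by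
      rw [← Fintype.prod_sum fun m (q : Fin d × Fin d) =>
        R (σ (tgPairFst k m)) q.1 (τ (tgPairFst k m)) q.2 *
          if σ (tgPairSnd k m) = q.1 ∧ τ (tgPairSnd k m) = q.2 then 1 else 0]
      exact Finset.prod_congr rfl fun m _ => sum_mul_ite_eq_pair
        (fun q => R (σ (tgPairFst k m)) q.1 (τ (tgPairFst k m)) q.2) (σ (tgPairSnd k m))
        (τ (tgPairSnd k m))
    simp_rw [hsplit]
    rw [← Finset.mul_sum, ← Finset.sum_mul, hlam, prod_filter_tail k (fun s => N (σ s) (τ s))]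
    by_cases hτ : τ (tgZero k) = i
    · simp only [hτ, if_true, mul_one]
      ring
    · simp only [hτ, if_false, mul_zero, zero_mul]
  -- (2) the product of linear elements for fixed `lam`
  have h2 : ∀ lam : Fin k → Fin d × Fin d, (∏ s, Lh (Mt lam s) : 𝒵 d) =
      Lh (fun a c => uL a * if c = i then (1 : ℝ) else 0) *
        (∏ m, (Lh (fun a c => R a (lam m).1 c (lam m).2) * zh (lam m).1 (lam m).2)) *
        Lh N ^ (d - (2 * (k : ℕ) + 1)) := by
    intro lam
    rw [← Fintype.prod_equiv (tgEquiv k) (fun q => Lh (Mt lam (tgEquiv k q))) _ (fun _ => rfl),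
      Fintype.prod_sum_type, Fintype.prod_sum_type, Fintype.prod_sum_type, ← Finset.prod_mul_distrib]
    simp only [tgEquiv_zero, tgEquiv_fst, tgEquiv_snd, tgEquiv_tail, hMt0, hMt1, hMt2, hMt3,
      Finset.univ_unique, Lh_single, Finset.prod_const, Finset.card_univ, Fintype.card_fin,
      Finset.card_singleton, pow_one, mul_assoc]
  have h2sum : (∑ lam : Fin k → Fin d × Fin d, ∏ s, Lh (Mt lam s) : 𝒵 d) =
      Lh (fun a c => uL a * if c = i then (1 : ℝ) else 0) * Qh R ^ (k : ℕ) *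
        Lh N ^ (d - (2 * (k : ℕ) + 1)) := by
    simp_rw [h2]
    rw [← Finset.sum_mul, ← Finset.mul_sum, ← Fintype.prod_sum fun (_ : Fin k) (q : Fin d × Fin d) =>
      Lh (fun a c => R a q.1 c q.2) * zh q.1 q.2]
    simp only [Finset.prod_const, Finset.card_univ, Fintype.card_fin, Qh, Fintype.sum_prod_type]
  -- assemble
  calc β d * tgSum uL R N k i
      = ∑ lam : Fin k → Fin d × Fin d, β d * ∑ σ : Equiv.Perm (Fin d), ∑ τ : Equiv.Perm (Fin d),
          ((Equiv.Perm.sign σ : ℤ) : ℝ) * ((Equiv.Perm.sign τ : ℤ) : ℝ) * ∏ s, Mt lam s (σ s) (τ s) := by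
        simp only [tgSum, h1, Finset.mul_sum]
        exact (Finset.sum_congr rfl fun σ _ => Finset.sum_comm).trans Finset.sum_comm
    _ = ∑ lam : Fin k → Fin d × Fin d, top ((∏ s, Lh (Mt lam s) : 𝒵 d) : Op (Fin (d + d))) := by
        simp only [top_prod_Lh]
    _ = top ((∑ lam : Fin k → Fin d × Fin d, ∏ s, Lh (Mt lam s) : 𝒵 d) : Op (Fin (d + d))) := by
        simp only [AddSubmonoidClass.coe_finsetSum, map_sum]
    _ = _ := by rw [h2sum]

end Bridge

/-! ### The pointwise algebraic form of Chern's identity -/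

section Final

variable (u v : Fin d → ℝ) (N : Fin d → Fin d → ℝ) (R : Fin d → Fin d → Fin d → Fin d → ℝ)
  (Γ : Fin d → Fin d → Fin d → ℝ) (δu : Fin d → Fin d → ℝ) (δN : Fin d → Fin d → Fin d → ℝ)
  (δR : Fin d → Fin d → Fin d → Fin d → Fin d → ℝ)

/-- `↑Q = -4 Ω̂`. [folklore] -/
theorem coe_Qh_eq_smul_Ωop : ((Qh R : 𝒵 d) : Op (Fin (d + d))) = (-4 : ℝ) • Ωop R := by
  rw [Ωop_eq_smul_Qh, smul_smul]
  norm_num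

/-- T-bridge in operator form: `β · tgSum = (-4)ᵏ top(θⁱ (S H^{d-1-2k} Ω̂ᵏ))`. [cite: Chern1945, (4)] -/
theorem β_mul_tgSum_eq_top (k : Fin (d / 2)) (i : Fin d) :
    β d * tgSum u R N k i =
      (-4 : ℝ) ^ (k : ℕ) * top (θ i * (Sop u * Hop N ^ (d - 1 - 2 * (k : ℕ)) * Ωop R ^ (k : ℕ))) := by
  rw [β_mul_tgSum, Subalgebra.coe_mul, Subalgebra.coe_mul, Subalgebra.coe_pow, Subalgebra.coe_pow,
    coe_Lh_slot0, coe_Lh, coe_Qh_eq_smul_Ωop, smul_pow,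
    show d - (2 * (k : ℕ) + 1) = d - 1 - 2 * (k : ℕ) by omega]
  simp only [mul_smul_comm, smul_mul_assoc, map_smul, smul_eq_mul]
  rw [mul_assoc (θ i * Sop u), mul_comm_of_mem_𝒵 (Subalgebra.pow_mem _ (Ωop_mem_𝒵 R) _)
    (Subalgebra.pow_mem _ (Hop_mem_𝒵 N) _)]
  simp only [mul_assoc]

/-- E-bridge in operator form: `β · eSum = (-4)ᵖ top(Ω̂ᵖ)`. [cite: Chern1945, (10)] -/
theorem β_mul_eSum_eq_top (hd : Even d) :
    β d * eSum R = (-4 : ℝ) ^ (d / 2) * top (Ωop R ^ (d / 2)) := by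
  rw [β_mul_eSum hd, Subalgebra.coe_pow, coe_Qh_eq_smul_Ωop, smul_pow, map_smul, smul_eq_mul]

/-- The `Ψ`-integrals `Fₖ = top (S K H^{d-2-2k} Ω̂ᵏ)` (Chern's `Ψₖ` pulled back, integrated).
[cite: Chern1945, (5)] -/
def Fk (k : ℕ) : ℝ := top (Sop u * Kop R v * Hop N ^ (d - 2 - 2 * k) * Ωop R ^ k)

/-- Chern's recursion `dΦₖ ↝ k Ψₖ₋₁ + (d-1-2k) Ψₖ` in integrated form. [cite: Chern1945, (6)–(8)] -/
theorem recursion_Fk (hA1 : ∑ a, v a * u a = 1) (hA2 : ∀ k, ∑ a, v a * N a k = 0)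
    (hA3 : ∀ a b k l, R a b k l = -R b a k l) {p : ℕ} (hd : d = 2 * p) {k : ℕ} (hk : k < p) :
    top (Hop N ^ (d - 1 - 2 * k + 1) * Ωop R ^ k) +
        ((d - 1 - 2 * k : ℕ) : ℝ) * top (Sop u * Kop R v * Hop N ^ (d - 1 - 2 * k - 1) * Ωop R ^ k) =
      (k : ℝ) * Fk u v N R (k - 1) + ((d - 1 - 2 * k : ℕ) : ℝ) * Fk u v N R k := by
  rw [top_Hpow_Ωpow u v N R hA1 hA2 hA3, Fk, Fk, show d - 1 - 2 * k - 1 = d - 2 - 2 * k by omega]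
  rcases Nat.eq_zero_or_pos k with rfl | hk0
  · simp
  · rw [show d - 1 - 2 * k + 1 = d - 2 - 2 * (k - 1) by omega]

/-- **Chern's transgression identity, pointwise algebraic form.** Given the values `u, v, N, R, Γ, ρ`
and derivative arrays `δu, δN, δR, δρ, δT` at a point satisfying the calculus identities
(A1)–(A3), (S1)–(S4) and the Leibniz form of `∂ᵢTₖ(i)`, the coordinate divergence of
`Πᵢ = -ρ ∑ₖ cₖ Tₖ(i)` equals the Euler density `ρ (4ᵖp!)⁻¹ E-sum`. [cite: Chern1945, (11)] -/
theorem chern_pointwise {p : ℕ} (hd : d = 2 * p) (hp : 0 < p) (ρ : ℝ) (δρ : Fin d → ℝ)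
    (hA1 : ∑ a, v a * u a = 1) (hA2 : ∀ k, ∑ a, v a * N a k = 0)
    (hA3 : ∀ a b k l, R a b k l = -R b a k l)
    (hS1 : ∀ a i, δu a i = N a i + ∑ b, Γ b i a * u b)
    (hS2 : ∀ a i k, δN a k i - δN a i k =
      (∑ c, R a c i k * v c) + ∑ b, (Γ b i a * N b k - Γ b k a * N b i))
    (hS3 : ∀ a b m k l, bianchiC R Γ δR a b m k l + bianchiC R Γ δR a b k l m +
      bianchiC R Γ δR a b l m k = 0)
    (hS4 : ∀ i, δρ i = -ρ * ∑ a, Γ a i a)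
    (δT : Fin (d / 2) → Fin d → ℝ)
    (hδT : ∀ (k : Fin (d / 2)) (i : Fin d), β d * δT k i =
      (-4 : ℝ) ^ (k : ℕ) * top (θ i * leibnizD u N R δu δN δR i (d - 1 - 2 * (k : ℕ)) k)) :
    -∑ i, (δρ i * ∑ k : Fin (d / 2), chernTransgressionCoeff d k * tgSum u R N k i +
        ρ * ∑ k : Fin (d / 2), chernTransgressionCoeff d k * δT k i) =
      ρ * ((4 : ℝ) ^ (d / 2) * ((d / 2)! : ℕ))⁻¹ * eSum R := by
  have hd2 : d / 2 = p := by omega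
  have hde : Even d := ⟨p, by omega⟩
  -- coefficient identity `cₖ (-4)ᵏ = γₖ`
  have hcγ : ∀ k : ℕ, chernTransgressionCoeff d k * (-4 : ℝ) ^ k = γcoeff d k := by
    intro k
    rw [chernTransgressionCoeff, γcoeff, show d - 2 * k - 1 = d - 1 - 2 * k by omega,
      show (-4 : ℝ) ^ k = (-1) ^ k * 4 ^ k by rw [← mul_pow]; norm_num]
    have h4 : (4 : ℝ) ^ k ≠ 0 := pow_ne_zero _ (by norm_num)
    have h1 : ((k ! : ℕ) : ℝ) ≠ 0 := by positivity
    have h2 : (((d - 1 - 2 * k)‼ : ℕ) : ℝ) ≠ 0 := by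
      exact_mod_cast (Nat.doubleFactorial_pos _).ne'
    field_simp
  refine mul_left_cancel₀ (β_ne_zero (d := d)) ?_
  -- left-hand side, term by term
  have hL : ∀ (k : Fin (d / 2)) (i : Fin d),
      β d * (δρ i * (chernTransgressionCoeff d k * tgSum u R N k i) +
        ρ * (chernTransgressionCoeff d k * δT k i)) =
      γcoeff d k * (δρ i * top (θ i * (Sop u * Hop N ^ (d - 1 - 2 * (k : ℕ)) * Ωop R ^ (k : ℕ))) +
        ρ * top (θ i * leibnizD u N R δu δN δR i (d - 1 - 2 * (k : ℕ)) k)) := by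
    intro k i
    rw [← hcγ]
    have e1 := β_mul_tgSum_eq_top u N R k i
    have e2 := hδT k i
    linear_combination δρ i * chernTransgressionCoeff d k * e1 + ρ * chernTransgressionCoeff d k * e2
  have hLHS : β d * -∑ i, (δρ i * ∑ k : Fin (d / 2), chernTransgressionCoeff d k * tgSum u R N k i +
      ρ * ∑ k : Fin (d / 2), chernTransgressionCoeff d k * δT k i) =
      -(ρ * ∑ k ∈ Finset.range p, γcoeff d k *
        ((k : ℕ) * Fk u v N R (k - 1) + ((d - 1 - 2 * k : ℕ) : ℝ) * Fk u v N R k)) := by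
    rw [mul_neg, neg_inj]
    have hi : ∀ i, δρ i * ∑ k : Fin (d / 2), chernTransgressionCoeff d k * tgSum u R N k i +
        ρ * ∑ k : Fin (d / 2), chernTransgressionCoeff d k * δT k i =
        ∑ k : Fin (d / 2), (δρ i * (chernTransgressionCoeff d k * tgSum u R N k i) +
          ρ * (chernTransgressionCoeff d k * δT k i)) := fun i => by
      rw [Finset.mul_sum, Finset.mul_sum, ← Finset.sum_add_distrib]
    rw [Finset.sum_congr rfl fun i _ => hi i, Finset.mul_sum]
    simp_rw [Finset.mul_sum, hL]
    rw [Finset.sum_comm, ← hd2, ← Fin.sum_univ_eq_sum_range (fun k => ρ * (γcoeff d k *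
      ((k : ℕ) * Fk u v N R (k - 1) + ((d - 1 - 2 * k : ℕ) : ℝ) * Fk u v N R k))) (d / 2)]
    refine Finset.sum_congr rfl fun k _ => ?_
    rw [← Finset.mul_sum, div_core u v N R Γ δu δN δR ρ δρ hS4 hS1 hS2 hS3,
      recursion_Fk u v N R hA1 hA2 hA3 hd (by omega : (k : ℕ) < p)]
    ring
  rw [hLHS, sum_γcoeff_telescope hd hp]
  -- right-hand side
  have hΩp : top (Ωop R ^ p) = (p : ℝ) * Fk u v N R (p - 1) := by
    have := top_Hpow_Ωpow u v N R hA1 hA2 hA3 0 p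
    rw [pow_zero, one_mul] at this
    rw [this, Fk, show d - 2 - 2 * (p - 1) = 0 by omega, pow_zero]
  symm
  calc β d * (ρ * ((4 : ℝ) ^ (d / 2) * ((d / 2)! : ℕ))⁻¹ * eSum R)
      = ρ * ((4 : ℝ) ^ (d / 2) * ((d / 2)! : ℕ))⁻¹ * (β d * eSum R) := by ring
    _ = ρ * ((4 : ℝ) ^ p * (p ! : ℕ))⁻¹ * ((-4 : ℝ) ^ p * ((p : ℝ) * Fk u v N R (p - 1))) := by
        rw [β_mul_eSum_eq_top R hde, hd2, hΩp]
    _ = -(ρ * ((-1) ^ (p - 1) / ((p - 1)! : ℕ) * Fk u v N R (p - 1))) := by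
        obtain ⟨q, rfl⟩ : ∃ q, p = q + 1 := ⟨p - 1, by omega⟩
        rw [Nat.add_sub_cancel, Nat.factorial_succ, pow_succ, pow_succ,
          show (-4 : ℝ) ^ q = (-1) ^ q * 4 ^ q by rw [← mul_pow]; norm_num]
        have h1 : ((q ! : ℕ) : ℝ) ≠ 0 := by positivity
        have h4 : (4 : ℝ) ^ q ≠ 0 := pow_ne_zero _ (by norm_num)
        push_cast
        field_simp

end Final

end Literature.Geometry.Riemannian.Fock
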